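import Literature.ModelTheory.ExponentialFields.SemialgebraicC1TriangulationProofs
import Literature.Analysis.Convexity.SignArrangementChainComplex
import Literature.Analysis.Convexity.PLMap
import Literature.ModelTheory.ExponentialFields.SemialgebraicSimplex
import HarnessLib

/-!
# `C¹`-triangulations of compact semialgebraic sets — proof file II: the lifting step

Second proof file (D-0026: theorems only, no new named facts) for the named fact
`Literature.ModelTheory.ExponentialFields.OhmotoShiota2017_c1Triangulation`
(`SemialgebraicC1Triangulation.lean`), continuing `SemialgebraicC1TriangulationProofs.lean`
(the gate caps a file at 200 kB).  It formalises the machinery of the **lifting lemma**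
[Dries1998, Ch. 8 (2.8)] of the inductive proof of the semialgebraic triangulation theorem
[Dries1998, Ch. 8 (2.9)]: given a triangulation `(Φ, K)` of `A ⊆ ℝⁿ` and finitely many continuous
sections `G₀ ≤ … ≤ G_q` over `A`, comparable on the cells and satisfying condition `(*)` of
(2.7)(2), one builds a complex `L` over `K` whose polyhedron is the band between the least and the
greatest *height* (the simplexwise affine interpolation of `Gᵢ ∘ Ψ`), and the homeomorphism
`Φ_L (x, Gᵢ x) = (Φ x, heightᵢ (Φ x))`, fibrewise piecewise linear in between.

## Main statements (all proved)

* `sort_apply_eq_of_forall_le_imp` — pairing of order statistics of two families with compatible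
  preorders (`Tuple.comp_sort_eq_comp_iff_monotone`).
* `convexHull_subset_closure_openSimplex`, `closure_openSimplex_eq`, `plMap_eqOn_of_eqOn_openSimplex`,
  `plMap_lt_plMap_on_openSimplex` — the heights `plMap K (Gᵢ ∘ Ψ)` are ordered on each open
  simplex exactly as the sections are (condition `(*)` enters here).
* `plInterpolant_monotone`, `plInterpolant_mem_Icc`, `band_homeomorph` — the band map
  `Ψ_L (x, s) = (Φ x, λ_x(s))` with the moving-node PL interpolant `λ` of
  `SemialgebraicC1TriangulationProofs.lean` is a homeomorphism between the bands, with explicit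
  inverse; `band_isSemialgebraicMapOn` — it is semialgebraic when the data are.
* `IsSemialgebraicFunOn.of_rel` — functions defined by a semialgebraic condition on the values of
  semialgebraic functions are semialgebraic; instances `max`, `min`, `div₀`, `finset_sum`,
  `sort_apply` (order statistics, via the first-order characterisation `eq_sort_apply_iff`).
* `exists_affine_detect` — affine functionals cutting out a closed / open simplex.
* `exists_simplicialComplex_band` — **the complex on the lifted band**: for heights affine on the
  closed simplices of a finite complex `K`, the closed band over `|K|` between the least and the
  greatest height is the polyhedron of a finite complex each of whose open simplices lies over one
  open simplex of `K` on a constant side of every height (sign-arrangement chain complex,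
  `Literature.Analysis.Convexity.SignArrangement.chainComplex`).
* `AffineMap.isSemialgebraicFunOn`, `isSemialgebraic_convexHull_of_affineIndependent'`,
  `isSemialgebraic_openSimplex`, `IsSemialgebraicMapOn.isSemialgebraic_sep_mem`,
  `IsSemialgebraicFunOn.of_finset_cover` — semialgebraicity of affine functionals, simplices,
  preimages under semialgebraic maps, piecewise-defined functions.
* `exists_openSimplex_sd_subset`, `sd_comparable_and_star` — open simplices of the barycentric
  subdivision refine those of `K`; comparability on the cells of `K` gives comparability and
  condition `(*)` on the cells of `sd K`.
* `plInterpolant_sign` — the fibre interpolant preserves the side of each node.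
* `exists_lifting` — **the lifting theorem** [Dries1998, Ch. 8 (2.8)]: the band `A^G` between the
  least and greatest of finitely many comparable continuous semialgebraic sections over a
  semialgebraically triangulated `A` has a finite semialgebraic triangulation lifting that of `A`,
  each open simplex lying over one open simplex of `K` on a constant side of every section.

## References

* [Dries1998] L. van den Dries, *Tame Topology and O-minimal Structures* (1998), Ch. 8 (1.4),
  (2.7), (2.8) (PDF pp. 145–154, read).
* [OhmotoShiota2017] T. Ohmoto, M. Shiota, *`C¹`-triangulations of semialgebraic sets*,
  J. Topology 10 (2017), Thm. 2.2 (the semialgebraic triangulation theorem being formalised).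
* [BochnakCosteRoy1998] J. Bochnak, M. Coste, M.-F. Roy, *Real Algebraic Geometry* (1998), §2.2
  (Prop. 2.2.6), Thm. 9.2.1.
-/

noncomputable section

open Set Filter
open _root_.Topology

namespace Literature.ModelTheory.ExponentialFields

/-- **Pairing of order statistics**: if the preorder of `a` refines that of `b`
(`a i ≤ a j → b i ≤ b j`) then the permutation sorting `a` also sorts `b`, so the `k`-th order
statistics of `a` and `b` are attained at a common index. [folklore] -/
theorem sort_apply_eq_of_forall_le_imp {m : ℕ} {a b : Fin m → ℝ}
    (h : ∀ i j, a i ≤ a j → b i ≤ b j) (k : Fin m) :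
    b (Tuple.sort b k) = b (Tuple.sort a k) := by
  have hmono : Monotone (b ∘ Tuple.sort a) := fun k k' hkk' => h _ _ (Tuple.monotone_sort a hkk')
  have heq := Tuple.comp_sort_eq_comp_iff_monotone.mpr hmono
  exact (congr_fun heq k).symm

/-! ## Heights over a complex: order lemmas for simplexwise affine interpolation

[cite: Dries1998, Ch. 8 (2.8), definition of `Φ_L` and `L`]: the lifted vertex heights are
interpolated simplexwise affinely (`Literature.Analysis.Convexity.plMap`); comparability of the
sections on each cell plus condition `(*)` of (2.7)(2) make the interpolated heights ordered on each
open simplex exactly as the sections are. -/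

section Heights

open Literature.Analysis.Convexity

variable {W : Type*} [NormedAddCommGroup W] [NormedSpace ℝ W]

/-- The closed simplex lies in the closure of the open simplex (push towards the barycentre).
[cite: Dries1998, Ch. 8 (1.4)] -/
theorem convexHull_subset_closure_openSimplex {s : Finset W}
    (hs : AffineIndependent ℝ ((↑) : s → W)) :
    convexHull ℝ (s : Set W) ⊆ closure (openSimplex ℝ s) := by
  intro y hy
  rw [openSimplex_eq_relInt hs]
  have hc : Continuous fun μ : ℝ => (1 - μ) • y + μ • bary s := by fun_prop
  have ht : Tendsto (fun μ : ℝ => (1 - μ) • y + μ • bary s) (𝓝[>] 0) (𝓝 y) := by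
    have := (hc.tendsto 0).mono_left (nhdsWithin_le_nhds (s := Set.Ioi (0 : ℝ)))
    simpa using this
  refine mem_closure_of_tendsto ht ?_
  filter_upwards [Ioo_mem_nhdsGT (zero_lt_one' ℝ)] with μ hμ
  exact combo_bary_mem_relInt hs hy hμ.1 hμ.2.le

/-- The closure of an open simplex is the closed simplex. [cite: Dries1998, Ch. 8 (1.4)] -/
theorem closure_openSimplex_eq {s : Finset W} (hs : AffineIndependent ℝ ((↑) : s → W)) :
    closure (openSimplex ℝ s) = convexHull ℝ (s : Set W) :=
  (closure_minimal (openSimplex_subset_convexHull (𝕜 := ℝ) s)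
    (s.finite_toSet.isClosed_convexHull (𝕜 := ℝ))).antisymm
    (convexHull_subset_closure_openSimplex hs)

/-- Functions continuous on a closed simplex which agree on the open simplex agree on the closed
simplex. [folklore] -/
theorem eqOn_convexHull_of_eqOn_openSimplex {β : Type*} [TopologicalSpace β] [T2Space β]
    {s : Finset W} (hs : AffineIndependent ℝ ((↑) : s → W)) {g₁ g₂ : W → β}
    (h₁ : ContinuousOn g₁ (convexHull ℝ (s : Set W))) (h₂ : ContinuousOn g₂ (convexHull ℝ (s : Set W)))
    (h : EqOn g₁ g₂ (openSimplex ℝ s)) : EqOn g₁ g₂ (convexHull ℝ (s : Set W)) :=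
  h.of_subset_closure h₁ h₂ (openSimplex_subset_convexHull (𝕜 := ℝ) s)
    (convexHull_subset_closure_openSimplex hs)

/-- Functions continuous on a closed simplex with `g₁ ≤ g₂` on the open simplex satisfy `g₁ ≤ g₂`
on the closed simplex. [folklore] -/
theorem le_on_convexHull_of_le_on_openSimplex {s : Finset W}
    (hs : AffineIndependent ℝ ((↑) : s → W)) {g₁ g₂ : W → ℝ}
    (h₁ : ContinuousOn g₁ (convexHull ℝ (s : Set W))) (h₂ : ContinuousOn g₂ (convexHull ℝ (s : Set W)))
    (h : ∀ p ∈ openSimplex ℝ s, g₁ p ≤ g₂ p) : ∀ p ∈ convexHull ℝ (s : Set W), g₁ p ≤ g₂ p := by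
  intro p hp
  rw [← closure_openSimplex_eq hs] at h₁ h₂ hp
  exact le_on_closure h h₁ h₂ hp

variable [FiniteDimensional ℝ W] {K : Geometry.SimplicialComplex ℝ W}

/-- **Equal sections have equal heights.** If two vertex data agree on an open simplex of `K`
(and are continuous on the closed simplex) then their simplexwise affine interpolations agree on
the closed simplex. [cite: Dries1998, Ch. 8 (2.8)] -/
theorem plMap_eqOn_of_eqOn_openSimplex {s : Finset W} (hs : s ∈ K.faces) {g₁ g₂ : W → ℝ}
    (h₁ : ContinuousOn g₁ (convexHull ℝ (s : Set W))) (h₂ : ContinuousOn g₂ (convexHull ℝ (s : Set W)))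
    (h : EqOn g₁ g₂ (openSimplex ℝ s)) :
    EqOn (plMap K g₁) (plMap K g₂) (convexHull ℝ (s : Set W)) := by
  have hvert : ∀ v ∈ s, g₁ v = g₂ v := fun v hv =>
    eqOn_convexHull_of_eqOn_openSimplex (K.indep hs) h₁ h₂ h (subset_convexHull ℝ _ hv)
  obtain ⟨A₁, hA₁, hA₁v⟩ := exists_affineMap_eqOn_plMap (K := K) (g := g₁) hs
  obtain ⟨A₂, hA₂, hA₂v⟩ := exists_affineMap_eqOn_plMap (K := K) (g := g₂) hs
  intro p hp
  rw [hA₁ hp, hA₂ hp]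
  exact affine_eqOn_convexHull_of_forall_eq
    (fun v hv => by rw [hA₁v v hv, hA₂v v hv, hvert v hv]) hp

/-- **Strictly ordered sections have strictly ordered heights** (this is where condition `(*)`
of [Dries1998, Ch. 8 (2.7)(2)] enters, as `hstar`): if `g₁ < g₂` on an open simplex of `K` and
equality of `g₁, g₂` at all vertices would force equality on the open simplex, then
`plMap K g₁ < plMap K g₂` on the open simplex. [cite: Dries1998, Ch. 8 (2.8)] -/
theorem plMap_lt_plMap_on_openSimplex {s : Finset W} (hs : s ∈ K.faces) {g₁ g₂ : W → ℝ}
    (h₁ : ContinuousOn g₁ (convexHull ℝ (s : Set W))) (h₂ : ContinuousOn g₂ (convexHull ℝ (s : Set W)))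
    (hlt : ∀ p ∈ openSimplex ℝ s, g₁ p < g₂ p)
    (hstar : (∀ v ∈ s, g₁ v = g₂ v) → EqOn g₁ g₂ (openSimplex ℝ s)) :
    ∀ p ∈ openSimplex ℝ s, plMap K g₁ p < plMap K g₂ p := by
  have hle : ∀ v ∈ s, g₁ v ≤ g₂ v := fun v hv =>
    le_on_convexHull_of_le_on_openSimplex (K.indep hs) h₁ h₂ (fun p hp => (hlt p hp).le) v
      (subset_convexHull ℝ _ hv)
  have hne : ∃ v ∈ s, g₁ v < g₂ v := by
    by_contra hall
    push Not at hall
    have heq : ∀ v ∈ s, g₁ v = g₂ v := fun v hv => le_antisymm (hle v hv) (hall v hv)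
    obtain ⟨p, hp⟩ := openSimplex_nonempty (𝕜 := ℝ) (K.nonempty_of_mem_faces hs)
    exact (hlt p hp).ne (hstar heq hp)
  intro p hp
  obtain ⟨w, hw0, hw1, hwp⟩ := hp
  rw [← hwp, plMap_sum_smul hs (fun v hv => (hw0 v hv).le) hw1,
    plMap_sum_smul hs (fun v hv => (hw0 v hv).le) hw1]
  simp only [smul_eq_mul]
  obtain ⟨v₀, hv₀, hlt₀⟩ := hne
  exact Finset.sum_lt_sum (fun v hv => mul_le_mul_of_nonneg_left (hle v hv) (hw0 v hv).le)
    ⟨v₀, hv₀, mul_lt_mul_of_pos_left hlt₀ (hw0 v₀ hv₀)⟩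

end Heights

/-! ## The band homeomorphism of the lifting step

[cite: Dries1998, Ch. 8 (2.8)]: `Φ_L (x, f_i(x)) = (Φ x, g_i(Φ x))`, extended fibrewise linearly
between consecutive sections.  Here the fibre maps are the moving-node PL interpolants of
§ PLInterpolation, the nodes being the order statistics of the sections and of the heights. -/

section BandHomeomorph

variable {X : Type*}

/-- The PL interpolant is monotone in the fibre variable. [folklore] -/
theorem plInterpolant_monotone {q : ℕ} {v w : Fin (q + 1) → X → ℝ}
    (hmono : ∀ x, Monotone fun j => v j x) (hmonow : ∀ x, Monotone fun j => w j x) (x : X) :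
    Monotone fun s : ℝ => w 0 x + ∑ j : Fin q, (w j.succ x - w (Fin.castSucc j) x) *
      max 0 (min 1 ((s - v (Fin.castSucc j) x) / (v j.succ x - v (Fin.castSucc j) x))) := by
  intro s t hst
  have hw : ∀ j : Fin q, 0 ≤ w j.succ x - w (Fin.castSucc j) x := fun j =>
    sub_nonneg.mpr (hmonow x (Fin.castSucc_lt_succ (i := j)).le)
  have hv : ∀ j : Fin q, 0 ≤ v j.succ x - v (Fin.castSucc j) x := fun j =>
    sub_nonneg.mpr (hmono x (Fin.castSucc_lt_succ (i := j)).le)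
  simp only
  refine add_le_add le_rfl (Finset.sum_le_sum fun j _ => mul_le_mul_of_nonneg_left ?_ (hw j))
  exact max_le_max le_rfl (min_le_min le_rfl
    (div_le_div_of_nonneg_right (by linarith) (hv j)))

/-- The PL interpolant takes values between the extreme target nodes. [folklore] -/
theorem plInterpolant_mem_Icc {q : ℕ} {v w : Fin (q + 1) → X → ℝ}
    (hmono : ∀ x, Monotone fun j => v j x) (hmonow : ∀ x, Monotone fun j => w j x)
    (htie : ∀ (j : Fin q) x, v (Fin.castSucc j) x = v j.succ x → w (Fin.castSucc j) x = w j.succ x)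
    (x : X) (s : ℝ) :
    w 0 x + ∑ j : Fin q, (w j.succ x - w (Fin.castSucc j) x) *
      max 0 (min 1 ((s - v (Fin.castSucc j) x) / (v j.succ x - v (Fin.castSucc j) x))) ∈
      Icc (w 0 x) (w (Fin.last q) x) := by
  have hm := plInterpolant_monotone (v := v) (w := w) hmono hmonow x
  constructor
  · have h := hm (min_le_left s (v 0 x))
    simp only at h
    rwa [plInterpolant_apply_of_le (v := v) (w := w) hmono x (min_le_right _ _)] at h
  · have h := hm (le_max_left s (v (Fin.last q) x))
    simp only at h
    rwa [plInterpolant_apply_of_ge (v := v) (w := w) hmono htie x (le_max_right _ _)] at h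

/-- **The band homeomorphism (topological part).** Let `Φ : A → P` be a homeomorphism with
inverse `Ψ`, and let `v₀ ≤ ⋯ ≤ v_q`, `w₀ ≤ ⋯ ≤ w_q` be continuous functions on `A` with the same
ties.  Then `Ψ_L (x, s) = (Φ x, λ_x(s))`, `λ_x` the PL interpolant carrying the nodes `v_k(x)` to
`w_k(x)`, is a homeomorphism of the band `{(x, s) : x ∈ A, v₀(x) ≤ s ≤ v_q(x)}` onto the band
`{(p, t) : p ∈ P, w₀(Ψ p) ≤ t ≤ w_q(Ψ p)}`, with inverse `Φ_L (p, t) = (Ψ p, μ_{Ψ p}(t))`.  All the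
data are parameters characterised by the hypotheses `hlam`, `hmu`, `hAG`, `hΛG`, `hΨL`, `hΦL`.
[cite: Dries1998, Ch. 8 (2.8)] -/
theorem band_homeomorph {n q : ℕ} {A P : Set (Fin n → ℝ)} {Φ Ψ : (Fin n → ℝ) → (Fin n → ℝ)}
    (hΦ : MapsTo Φ A P) (hΨ : MapsTo Ψ P A) (hΨΦ : ∀ x ∈ A, Ψ (Φ x) = x)
    (hΦΨ : ∀ p ∈ P, Φ (Ψ p) = p) (hΦc : ContinuousOn Φ A) (hΨc : ContinuousOn Ψ P)
    {v w : Fin (q + 1) → (Fin n → ℝ) → ℝ} (hvc : ∀ k, ContinuousOn (v k) A)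
    (hwc : ∀ k, ContinuousOn (w k) A) (hvm : ∀ x ∈ A, Monotone fun k => v k x)
    (hwm : ∀ x ∈ A, Monotone fun k => w k x)
    (htie : ∀ x ∈ A, ∀ j : Fin q,
      v (Fin.castSucc j) x = v j.succ x ↔ w (Fin.castSucc j) x = w j.succ x)
    {lam mu : (Fin n → ℝ) → ℝ → ℝ}
    (hlam : ∀ x s, lam x s = w 0 x + ∑ j : Fin q, (w j.succ x - w (Fin.castSucc j) x) *
      max 0 (min 1 ((s - v (Fin.castSucc j) x) / (v j.succ x - v (Fin.castSucc j) x))))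
    (hmu : ∀ x t, mu x t = v 0 x + ∑ j : Fin q, (v j.succ x - v (Fin.castSucc j) x) *
      max 0 (min 1 ((t - w (Fin.castSucc j) x) / (w j.succ x - w (Fin.castSucc j) x))))
    {AG ΛG : Set (Fin (n + 1) → ℝ)}
    (hAG : ∀ z, z ∈ AG ↔ Fin.init z ∈ A ∧ v 0 (Fin.init z) ≤ z (Fin.last n) ∧
      z (Fin.last n) ≤ v (Fin.last q) (Fin.init z))
    (hΛG : ∀ z, z ∈ ΛG ↔ Fin.init z ∈ P ∧ w 0 (Ψ (Fin.init z)) ≤ z (Fin.last n) ∧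
      z (Fin.last n) ≤ w (Fin.last q) (Ψ (Fin.init z)))
    {ΨL ΦL : (Fin (n + 1) → ℝ) → (Fin (n + 1) → ℝ)}
    (hΨL : ∀ z, ΨL z = Fin.snoc (Φ (Fin.init z)) (lam (Fin.init z) (z (Fin.last n))))
    (hΦL : ∀ z, ΦL z = Fin.snoc (Ψ (Fin.init z)) (mu (Ψ (Fin.init z)) (z (Fin.last n)))) :
    MapsTo ΨL AG ΛG ∧ MapsTo ΦL ΛG AG ∧ (∀ z ∈ AG, ΦL (ΨL z) = z) ∧ (∀ z ∈ ΛG, ΨL (ΦL z) = z) ∧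
      ContinuousOn ΨL AG ∧ ContinuousOn ΦL ΛG := by
  -- transfer the PL lemmas to the subtype `A`
  let v' : Fin (q + 1) → A → ℝ := fun k x => v k x
  let w' : Fin (q + 1) → A → ℝ := fun k x => w k x
  have hmono' : ∀ x : A, Monotone fun j => v' j x := fun x => hvm x x.2
  have hmonow' : ∀ x : A, Monotone fun j => w' j x := fun x => hwm x x.2
  have htie' : ∀ (j : Fin q) (x : A), v' (Fin.castSucc j) x = v' j.succ x →
      w' (Fin.castSucc j) x = w' j.succ x := fun j x => (htie x x.2 j).mp
  have htie'' : ∀ (j : Fin q) (x : A), w' (Fin.castSucc j) x = w' j.succ x →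
      v' (Fin.castSucc j) x = v' j.succ x := fun j x => (htie x x.2 j).mpr
  have hlam_mem : ∀ x ∈ A, ∀ s, lam x s ∈ Icc (w 0 x) (w (Fin.last q) x) := fun x hx s => by
    rw [hlam]
    exact plInterpolant_mem_Icc (v := v') (w := w') hmono' hmonow' htie' ⟨x, hx⟩ s
  have hmu_mem : ∀ x ∈ A, ∀ t, mu x t ∈ Icc (v 0 x) (v (Fin.last q) x) := fun x hx t => by
    rw [hmu]
    exact plInterpolant_mem_Icc (v := w') (w := v') hmonow' hmono' htie'' ⟨x, hx⟩ t
  have hmu_lam : ∀ x ∈ A, ∀ s ∈ Icc (v 0 x) (v (Fin.last q) x), mu x (lam x s) = s :=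
    fun x hx s hs => by
      rw [hmu, hlam]
      exact plInterpolant_inverse (v := v') (w := w') hmono' hmonow' htie' htie'' ⟨x, hx⟩ hs
  have hlam_mu : ∀ x ∈ A, ∀ t ∈ Icc (w 0 x) (w (Fin.last q) x), lam x (mu x t) = t :=
    fun x hx t ht => by
      rw [hlam, hmu]
      exact plInterpolant_inverse (v := w') (w := v') hmonow' hmono' htie'' htie' ⟨x, hx⟩ ht
  -- joint continuity of the fibre maps
  have hvc' : ∀ j, Continuous (v' j) := fun j => continuousOn_iff_continuous_restrict.mp (hvc j)
  have hwc' : ∀ j, Continuous (w' j) := fun j => continuousOn_iff_continuous_restrict.mp (hwc j)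
  have hL : Continuous fun p : A × ℝ => lam p.1 p.2 :=
    (continuous_plInterpolant (v := v') (w := w') hvc' hwc' htie').congr
      fun p => (hlam p.1 p.2).symm
  have hM : Continuous fun p : A × ℝ => mu p.1 p.2 :=
    (continuous_plInterpolant (v := w') (w := v') hwc' hvc' htie'').congr
      fun p => (hmu p.1 p.2).symm
  have hinit : Continuous (Fin.init : (Fin (n + 1) → ℝ) → Fin n → ℝ) := continuous_id.finInit
  have hlast : Continuous fun z : Fin (n + 1) → ℝ => z (Fin.last n) := continuous_apply _
  refine ⟨fun z hz => ?_, fun z hz => ?_, fun z hz => ?_, fun z hz => ?_, ?_, ?_⟩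
  · obtain ⟨hxA, -⟩ := (hAG z).mp hz
    rw [hΛG, hΨL]
    simp only [Fin.init_snoc, Fin.snoc_last]
    rw [hΨΦ _ hxA]
    exact ⟨hΦ hxA, (hlam_mem _ hxA _).1, (hlam_mem _ hxA _).2⟩
  · obtain ⟨hpP, -⟩ := (hΛG z).mp hz
    rw [hAG, hΦL]
    simp only [Fin.init_snoc, Fin.snoc_last]
    exact ⟨hΨ hpP, (hmu_mem _ (hΨ hpP) _).1, (hmu_mem _ (hΨ hpP) _).2⟩
  · obtain ⟨hxA, hs⟩ := (hAG z).mp hz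
    rw [hΦL, hΨL]
    simp only [Fin.init_snoc, Fin.snoc_last]
    rw [hΨΦ _ hxA, hmu_lam _ hxA _ hs, Fin.snoc_init_self]
  · obtain ⟨hpP, ht⟩ := (hΛG z).mp hz
    rw [hΨL, hΦL]
    simp only [Fin.init_snoc, Fin.snoc_last]
    rw [hΦΨ _ hpP, hlam_mu _ (hΨ hpP) _ ht, Fin.snoc_init_self]
  · have hsub : AG ⊆ {z | Fin.init z ∈ A} := fun z hz => ((hAG z).mp hz).1
    set T : Set (Fin (n + 1) → ℝ) := {z | Fin.init z ∈ A} with hT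
    have h1 : ContinuousOn (fun z : Fin (n + 1) → ℝ => Φ (Fin.init z)) T :=
      hΦc.comp hinit.continuousOn fun z hz => hz
    have h2 : ContinuousOn (fun z : Fin (n + 1) → ℝ => lam (Fin.init z) (z (Fin.last n))) T := by
      rw [continuousOn_iff_continuous_restrict]
      have hj1 : Continuous fun z : T => ((⟨Fin.init (z : Fin (n + 1) → ℝ), z.2⟩ : A)) :=
        (hinit.comp continuous_subtype_val).subtype_mk fun z : T => z.2
      have hj : Continuous fun z : T =>
          ((⟨Fin.init (z : Fin (n + 1) → ℝ), z.2⟩ : A), (z : Fin (n + 1) → ℝ) (Fin.last n)) :=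
        hj1.prodMk (hlast.comp continuous_subtype_val)
      exact hL.comp hj
    have h : ContinuousOn (fun z : Fin (n + 1) → ℝ =>
        (Fin.snoc (Φ (Fin.init z)) (lam (Fin.init z) (z (Fin.last n))) : Fin (n + 1) → ℝ)) T :=
      h1.finSnoc h2
    exact (h.mono hsub).congr fun z _ => hΨL z
  · have hsub : ΛG ⊆ {z | Fin.init z ∈ P} := fun z hz => ((hΛG z).mp hz).1
    set T : Set (Fin (n + 1) → ℝ) := {z | Fin.init z ∈ P} with hT
    have h1 : ContinuousOn (fun z : Fin (n + 1) → ℝ => Ψ (Fin.init z)) T :=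
      hΨc.comp hinit.continuousOn fun z hz => hz
    have h2 : ContinuousOn (fun z : Fin (n + 1) → ℝ => mu (Ψ (Fin.init z)) (z (Fin.last n))) T := by
      rw [continuousOn_iff_continuous_restrict]
      have hg : Continuous fun z : T => Ψ (Fin.init (z : Fin (n + 1) → ℝ)) :=
        continuousOn_iff_continuous_restrict.mp h1
      have hj1 : Continuous fun z : T => ((⟨Ψ (Fin.init (z : Fin (n + 1) → ℝ)), hΨ z.2⟩ : A)) :=
        hg.subtype_mk fun z : T => hΨ z.2
      have hj : Continuous fun z : T =>
          ((⟨Ψ (Fin.init (z : Fin (n + 1) → ℝ)), hΨ z.2⟩ : A), (z : Fin (n + 1) → ℝ) (Fin.last n)) :=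
        hj1.prodMk (hlast.comp continuous_subtype_val)
      exact hM.comp hj
    have h : ContinuousOn (fun z : Fin (n + 1) → ℝ =>
        (Fin.snoc (Ψ (Fin.init z)) (mu (Ψ (Fin.init z)) (z (Fin.last n))) : Fin (n + 1) → ℝ)) T :=
      h1.finSnoc h2
    exact (h.mono hsub).congr fun z _ => hΦL z

end BandHomeomorph

/-! ## Semialgebraic functions defined by first-order conditions on other functions

[cite: BochnakCosteRoy1998, Prop. 2.2.6 and §2.2]: a function whose value is characterised by a
semialgebraic condition on the values of finitely many semialgebraic functions is semialgebraic;
instances: `max`, `min`, division (with `x / 0 = 0`), finite sums and order statistics. -/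

section FunctionsFromRelations

open Literature.NumberTheory.Transcendental (IsSemialgebraicFunOn IsSemialgebraicMapOn
  isSemialgebraicFunOn_iff)
open Literature.NumberTheory.Transcendental.SemialgebraicMonotonicity

variable {n : ℕ}

/-- Finite conjunctions of real-semialgebraic conditions are real-semialgebraic.
[cite: BochnakCosteRoy1998, §2.1] -/
theorem sa_fin_forall {ι : Type*} [Fintype ι] {P : ι → (Fin n → ℝ) → Prop}
    (h : ∀ i, IsSemialgebraic ℝ {z | P i z}) : IsSemialgebraic ℝ {z | ∀ i, P i z} := by
  have h' := IsSemialgebraic.biInter (k := ℝ) Finset.univ (fun i => {z : Fin n → ℝ | P i z})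
    fun i _ => h i
  convert h' using 1
  ext z
  simp

/-- Finite disjunctions of real-semialgebraic conditions are real-semialgebraic.
[cite: BochnakCosteRoy1998, §2.1] -/
theorem sa_fin_exists {ι : Type*} [Fintype ι] {P : ι → (Fin n → ℝ) → Prop}
    (h : ∀ i, IsSemialgebraic ℝ {z | P i z}) : IsSemialgebraic ℝ {z | ∃ i, P i z} := by
  have h' := IsSemialgebraic.biUnion (k := ℝ) Finset.univ (fun i => {z : Fin n → ℝ | P i z})
    fun i _ => h i
  convert h' using 1
  ext z
  simp

/-- Conjunctions over a finset are real-semialgebraic. [cite: BochnakCosteRoy1998, §2.1] -/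
theorem sa_finset_forall {ι : Type*} (I : Finset ι) {P : ι → (Fin n → ℝ) → Prop}
    (h : ∀ i ∈ I, IsSemialgebraic ℝ {z | P i z}) : IsSemialgebraic ℝ {z | ∀ i ∈ I, P i z} := by
  have h' := IsSemialgebraic.biInter (k := ℝ) I (fun i => {z : Fin n → ℝ | P i z}) h
  convert h' using 1
  ext z
  simp

/-- Disjunctions over a finset are real-semialgebraic. [cite: BochnakCosteRoy1998, §2.1] -/
theorem sa_finset_exists {ι : Type*} (I : Finset ι) {P : ι → (Fin n → ℝ) → Prop}
    (h : ∀ i ∈ I, IsSemialgebraic ℝ {z | P i z}) : IsSemialgebraic ℝ {z | ∃ i ∈ I, P i z} := by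
  have h' := IsSemialgebraic.biUnion (k := ℝ) I (fun i => {z : Fin n → ℝ | P i z}) h
  convert h' using 1
  ext z
  simp

/-- **Functions defined by semialgebraic conditions on semialgebraic functions.** If
`f₀, …, f_{N-1}` are real-semialgebraic on a semialgebraic `s`, `R(a, t)` is a semialgebraic
relation on `ℝᴺ × ℝ`, and `H x` is the unique `t` with `R((fᵢ x)ᵢ, t)` for `x ∈ s`, then `H` is
real-semialgebraic on `s`: its graph is the projection along `a ∈ ℝᴺ` of
`{(x, t, a) | x ∈ s ∧ (∀ i, aᵢ = fᵢ x) ∧ R(a, t)}`. [cite: BochnakCosteRoy1998, Prop. 2.2.6] -/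
theorem IsSemialgebraicFunOn.of_rel {N : ℕ} {s : Set (Fin n → ℝ)} (hs : IsSemialgebraic ℝ s)
    {f : Fin N → (Fin n → ℝ) → ℝ} (hf : ∀ i, IsSemialgebraicFunOn ℝ s (f i))
    {R : (Fin N → ℝ) → ℝ → Prop}
    (hR : IsSemialgebraic ℝ {q : Fin (N + 1) → ℝ | R (Fin.init q) (q (Fin.last N))})
    {H : (Fin n → ℝ) → ℝ} (hH : ∀ x ∈ s, ∀ t, R (fun i => f i x) t ↔ t = H x) :
    IsSemialgebraicFunOn ℝ s H := by
  rw [isSemialgebraicFunOn_iff]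
  -- coordinates of `w ∈ ℝ^{(n+1)+N}`: `(x, t)` first, then `a`
  let xpart : (Fin (n + 1 + N) → ℝ) → Fin n → ℝ := fun w i => w (Fin.castAdd N (Fin.castSucc i))
  let tpart : (Fin (n + 1 + N) → ℝ) → ℝ := fun w => w (Fin.castAdd N (Fin.last n))
  let apart : (Fin (n + 1 + N) → ℝ) → Fin N → ℝ := fun w j => w (Fin.natAdd (n + 1) j)
  have h1 : IsSemialgebraic ℝ {w : Fin (n + 1 + N) → ℝ | xpart w ∈ s} :=
    hs.preimage_comp (fun i : Fin n => Fin.castAdd N (Fin.castSucc i))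
  have h2 : ∀ i, IsSemialgebraic ℝ
      {w : Fin (n + 1 + N) → ℝ | xpart w ∈ s ∧ apart w i = f i (xpart w)} := by
    intro i
    have hΓ := isSemialgebraicFunOn_iff.mp (hf i)
    let θ : Fin (n + 1) → Fin (n + 1 + N) :=
      Fin.snoc (fun i' : Fin n => Fin.castAdd N (Fin.castSucc i')) (Fin.natAdd (n + 1) i)
    have hθ : ∀ w : Fin (n + 1 + N) → ℝ, w ∘ θ = Fin.snoc (xpart w) (apart w i) := by
      intro w
      funext l
      refine Fin.lastCases ?_ (fun i' => ?_) l
      · simp [θ, apart]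
      · simp [θ, xpart]
    have h := hΓ.preimage_comp θ
    convert h using 1
    ext w
    simp only [mem_setOf_eq, mem_preimage, hθ, Fin.init_snoc, Fin.snoc_last]
  have h3 : IsSemialgebraic ℝ {w : Fin (n + 1 + N) → ℝ | R (apart w) (tpart w)} := by
    let θ : Fin (N + 1) → Fin (n + 1 + N) :=
      Fin.snoc (fun j : Fin N => Fin.natAdd (n + 1) j) (Fin.castAdd N (Fin.last n))
    have hθ : ∀ w : Fin (n + 1 + N) → ℝ, w ∘ θ = Fin.snoc (apart w) (tpart w) := by
      intro w
      funext l
      refine Fin.lastCases ?_ (fun j => ?_) l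
      · simp [θ, tpart]
      · simp [θ, apart]
    have h := hR.preimage_comp θ
    convert h using 1
    ext w
    simp only [mem_setOf_eq, mem_preimage, hθ, Fin.init_snoc, Fin.snoc_last]
  have key : IsSemialgebraic ℝ {w : Fin (n + 1 + N) → ℝ |
      xpart w ∈ s ∧ (∀ i, xpart w ∈ s ∧ apart w i = f i (xpart w)) ∧ R (apart w) (tpart w)} :=
    sa_and h1 (sa_and (sa_fin_forall h2) h3)
  have hex := sa_exists_block (m := n + 1) (n := N)
    (P := fun v a => Fin.init v ∈ s ∧ (∀ i, Fin.init v ∈ s ∧ a i = f i (Fin.init v)) ∧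
      R a (v (Fin.last n))) key
  convert hex using 1
  ext v
  simp only [mem_setOf_eq]
  constructor
  · rintro ⟨hv, ht⟩
    exact ⟨fun i => f i (Fin.init v), hv, fun i => ⟨hv, rfl⟩, (hH _ hv _).mpr ht⟩
  · rintro ⟨a, hv, ha, hRa⟩
    have : a = fun i => f i (Fin.init v) := funext fun i => (ha i).2
    subst this
    exact ⟨hv, (hH _ hv _).mp hRa⟩

/-- The pointwise `max` of two real-semialgebraic functions is real-semialgebraic.
[cite: BochnakCosteRoy1998, Prop. 2.2.6] -/
theorem IsSemialgebraicFunOn.max {s : Set (Fin n → ℝ)} (hs : IsSemialgebraic ℝ s)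
    {f g : (Fin n → ℝ) → ℝ} (hf : IsSemialgebraicFunOn ℝ s f) (hg : IsSemialgebraicFunOn ℝ s g) :
    IsSemialgebraicFunOn ℝ s (fun x => max (f x) (g x)) := by
  refine IsSemialgebraicFunOn.of_rel (N := 2) hs (f := ![f, g]) (fun i => ?_)
    (R := fun a t => (a 0 ≤ a 1 ∧ t = a 1) ∨ (a 1 < a 0 ∧ t = a 0)) ?_ (fun x _ t => ?_)
  · fin_cases i <;> simpa
  · have h : IsSemialgebraic ℝ {q : Fin (2 + 1) → ℝ |
        (q 0 ≤ q 1 ∧ q (Fin.last 2) = q 1) ∨ (q 1 < q 0 ∧ q (Fin.last 2) = q 0)} :=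
      sa_or (sa_and (sa_le 0 1) (sa_eq _ 1)) (sa_and (sa_lt 1 0) (sa_eq _ 0))
    convert h using 1
    ext q
    simp [Fin.init]
  · simp only [Matrix.cons_val_zero, Matrix.cons_val_one]
    constructor
    · rintro (⟨hle, rfl⟩ | ⟨hlt, rfl⟩)
      · exact (max_eq_right hle).symm
      · exact (max_eq_left hlt.le).symm
    · rintro rfl
      rcases le_or_gt (f x) (g x) with hle | hlt
      · exact Or.inl ⟨hle, max_eq_right hle⟩
      · exact Or.inr ⟨hlt, max_eq_left hlt.le⟩

/-- The pointwise `min` of two real-semialgebraic functions is real-semialgebraic.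
[cite: BochnakCosteRoy1998, Prop. 2.2.6] -/
theorem IsSemialgebraicFunOn.min {s : Set (Fin n → ℝ)} (hs : IsSemialgebraic ℝ s)
    {f g : (Fin n → ℝ) → ℝ} (hf : IsSemialgebraicFunOn ℝ s f) (hg : IsSemialgebraicFunOn ℝ s g) :
    IsSemialgebraicFunOn ℝ s (fun x => min (f x) (g x)) := by
  refine IsSemialgebraicFunOn.of_rel (N := 2) hs (f := ![f, g]) (fun i => ?_)
    (R := fun a t => (a 0 ≤ a 1 ∧ t = a 0) ∨ (a 1 < a 0 ∧ t = a 1)) ?_ (fun x _ t => ?_)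
  · fin_cases i <;> simpa
  · have h : IsSemialgebraic ℝ {q : Fin (2 + 1) → ℝ |
        (q 0 ≤ q 1 ∧ q (Fin.last 2) = q 0) ∨ (q 1 < q 0 ∧ q (Fin.last 2) = q 1)} :=
      sa_or (sa_and (sa_le 0 1) (sa_eq _ 0)) (sa_and (sa_lt 1 0) (sa_eq _ 1))
    convert h using 1
    ext q
    simp [Fin.init]
  · simp only [Matrix.cons_val_zero, Matrix.cons_val_one]
    constructor
    · rintro (⟨hle, rfl⟩ | ⟨hlt, rfl⟩)
      · exact (min_eq_left hle).symm
      · exact (min_eq_right hlt.le).symm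
    · rintro rfl
      rcases le_or_gt (f x) (g x) with hle | hlt
      · exact Or.inl ⟨hle, min_eq_left hle⟩
      · exact Or.inr ⟨hlt, min_eq_right hlt.le⟩

/-- The pointwise quotient (with Lean's `a / 0 = 0`) of two real-semialgebraic functions is
real-semialgebraic. [cite: BochnakCosteRoy1998, Prop. 2.2.6] -/
theorem IsSemialgebraicFunOn.div₀ {s : Set (Fin n → ℝ)} (hs : IsSemialgebraic ℝ s)
    {f g : (Fin n → ℝ) → ℝ} (hf : IsSemialgebraicFunOn ℝ s f) (hg : IsSemialgebraicFunOn ℝ s g) :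
    IsSemialgebraicFunOn ℝ s (fun x => f x / g x) := by
  refine IsSemialgebraicFunOn.of_rel (N := 2) hs (f := ![f, g]) (fun i => ?_)
    (R := fun a t => (a 1 = 0 ∧ t = 0) ∨ (¬ a 1 = 0 ∧ t * a 1 = a 0)) ?_ (fun x _ t => ?_)
  · fin_cases i <;> simpa
  · have hmul : IsSemialgebraic ℝ {q : Fin (2 + 1) → ℝ | q (Fin.last 2) * q 1 = q 0} := by
      have h := isSemialgebraic_setOf_eval_eq_zero (k := ℝ) (R := ℝ)
        (MvPolynomial.X (Fin.last 2) * MvPolynomial.X 1 - MvPolynomial.X 0 :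
          MvPolynomial (Fin (2 + 1)) ℝ)
      convert h using 2 with q
      simp [sub_eq_zero]
    have h : IsSemialgebraic ℝ {q : Fin (2 + 1) → ℝ |
        (q 1 = 0 ∧ q (Fin.last 2) = 0) ∨ (¬ q 1 = 0 ∧ q (Fin.last 2) * q 1 = q 0)} :=
      sa_or (sa_and (sa_eq_const 1 0) (sa_eq_const _ 0)) (sa_and (sa_not (sa_eq_const 1 0)) hmul)
    convert h using 1
    ext q
    simp [Fin.init]
  · simp only [Matrix.cons_val_zero, Matrix.cons_val_one]
    constructor
    · rintro (⟨h0, rfl⟩ | ⟨h0, h⟩)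
      · rw [h0, div_zero]
      · rw [eq_div_iff h0, h]
    · rintro rfl
      by_cases h0 : g x = 0
      · exact Or.inl ⟨h0, by rw [h0, div_zero]⟩
      · exact Or.inr ⟨h0, div_mul_cancel₀ _ h0⟩

/-- Constant real functions are real-semialgebraic. [cite: BochnakCosteRoy1998, §2.2] -/
theorem isSemialgebraicFunOn_const' {s : Set (Fin n → ℝ)} (hs : IsSemialgebraic ℝ s) (c : ℝ) :
    IsSemialgebraicFunOn ℝ s (fun _ => c) := by
  simpa using isSemialgebraicFunOn_algebraMap hs c

/-- Finite sums of real-semialgebraic functions are real-semialgebraic.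
[cite: BochnakCosteRoy1998, Prop. 2.2.6] -/
theorem IsSemialgebraicFunOn.finset_sum {ι : Type*} {s : Set (Fin n → ℝ)} (hs : IsSemialgebraic ℝ s)
    (I : Finset ι) {f : ι → (Fin n → ℝ) → ℝ} (hf : ∀ i ∈ I, IsSemialgebraicFunOn ℝ s (f i)) :
    IsSemialgebraicFunOn ℝ s (fun x => ∑ i ∈ I, f i x) := by
  classical
  induction I using Finset.induction_on with
  | empty => simpa using isSemialgebraicFunOn_const' hs 0
  | insert a I ha ih =>
    have h := IsSemialgebraicFunOn.add_holds (hf a (Finset.mem_insert_self a I))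
      (ih fun i hi => hf i (Finset.mem_insert_of_mem hi))
    refine h.congr fun x _ => ?_
    simp [Finset.sum_insert ha]

/-- Converse rank bound: at most `k` values lie strictly below the `k`-th order statistic.
[folklore] -/
theorem card_lt_sort_apply_le {m : ℕ} (f : Fin m → ℝ) (k : Fin m) :
    (Finset.univ.filter fun i => f i < f (Tuple.sort f k)).card ≤ k := by
  classical
  have hsub : (Finset.univ.filter fun i => f i < f (Tuple.sort f k)) ⊆
      (Finset.Iio k).image (Tuple.sort f) := by
    intro i hi
    have hi' := (Finset.mem_filter.mp hi).2
    refine Finset.mem_image.mpr ⟨(Tuple.sort f).symm i, Finset.mem_Iio.mpr ?_,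
      Equiv.apply_symm_apply _ _⟩
    by_contra hge
    push Not at hge
    have hmono := Tuple.monotone_sort f hge
    simp only [Function.comp_apply, Equiv.apply_symm_apply] at hmono
    linarith
  have hcard := (Finset.card_le_card hsub).trans Finset.card_image_le
  rwa [Fin.card_Iio] at hcard

/-- Converse rank bound: at least `k + 1` values are `≤` the `k`-th order statistic. [folklore] -/
theorem succ_le_card_le_sort_apply {m : ℕ} (f : Fin m → ℝ) (k : Fin m) :
    (k : ℕ) + 1 ≤ (Finset.univ.filter fun i => f i ≤ f (Tuple.sort f k)).card := by
  classical
  have hsub : (Finset.Iic k).image (Tuple.sort f) ⊆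
      Finset.univ.filter fun i => f i ≤ f (Tuple.sort f k) := by
    intro i hi
    obtain ⟨j, hj, rfl⟩ := Finset.mem_image.mp hi
    refine Finset.mem_filter.mpr ⟨Finset.mem_univ _, ?_⟩
    have hmono := Tuple.monotone_sort f (Finset.mem_Iic.mp hj)
    simpa only [Function.comp_apply] using hmono
  have hcard := Finset.card_le_card hsub
  rwa [Finset.card_image_of_injective _ (Tuple.sort f).injective, Fin.card_Iic] at hcard

/-- **First-order characterisation of order statistics**: `t` is the `k`-th order statistic of
`a` iff every `(k+1)`-set of indices contains one with `t ≤ aᵢ` and some `(k+1)`-set of indices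
has all `aᵢ ≤ t`. [folklore] -/
theorem eq_sort_apply_iff {m : ℕ} (a : Fin m → ℝ) (k : Fin m) (t : ℝ) :
    ((∀ I : Finset (Fin m), I.card = (k : ℕ) + 1 → ∃ i ∈ I, t ≤ a i) ∧
      ∃ I : Finset (Fin m), I.card = (k : ℕ) + 1 ∧ ∀ i ∈ I, a i ≤ t) ↔
      t = a (Tuple.sort a k) := by
  classical
  constructor
  · rintro ⟨h1, I, hI, hIle⟩
    apply le_antisymm
    · apply le_sort_apply_of_card_le
      by_contra hlt
      push Not at hlt
      obtain ⟨J, hJ, hJcard⟩ := Finset.exists_subset_card_eq (Nat.succ_le_of_lt hlt)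
      obtain ⟨i, hi, hti⟩ := h1 J hJcard
      exact absurd hti (not_le.mpr (Finset.mem_filter.mp (hJ hi)).2)
    · apply sort_apply_le_of_card_le
      calc (k : ℕ) + 1 = I.card := hI.symm
        _ ≤ _ := Finset.card_le_card fun i hi =>
          Finset.mem_filter.mpr ⟨Finset.mem_univ _, hIle i hi⟩
  · rintro rfl
    constructor
    · intro I hI
      by_contra hall
      push Not at hall
      have hsub : I ⊆ Finset.univ.filter fun i => a i < a (Tuple.sort a k) := fun i hi =>
        Finset.mem_filter.mpr ⟨Finset.mem_univ _, hall i hi⟩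
      have := (Finset.card_le_card hsub).trans (card_lt_sort_apply_le a k)
      omega
    · obtain ⟨I, hI, hIcard⟩ := Finset.exists_subset_card_eq (succ_le_card_le_sort_apply a k)
      exact ⟨I, hIcard, fun i hi => (Finset.mem_filter.mp (hI hi)).2⟩

/-- **Order statistics of semialgebraic functions are semialgebraic.**
[cite: BochnakCosteRoy1998, Prop. 2.2.6] -/
theorem IsSemialgebraicFunOn.sort_apply {m : ℕ} {s : Set (Fin n → ℝ)} (hs : IsSemialgebraic ℝ s)
    {f : Fin m → (Fin n → ℝ) → ℝ} (hf : ∀ i, IsSemialgebraicFunOn ℝ s (f i)) (k : Fin m) :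
    IsSemialgebraicFunOn ℝ s (fun x => (fun i => f i x) (Tuple.sort (fun i => f i x) k)) := by
  refine IsSemialgebraicFunOn.of_rel hs hf
    (R := fun a t => (∀ I : Finset (Fin m), I.card = (k : ℕ) + 1 → ∃ i ∈ I, t ≤ a i) ∧
      ∃ I : Finset (Fin m), I.card = (k : ℕ) + 1 ∧ ∀ i ∈ I, a i ≤ t) ?_
    (fun x _ t => eq_sort_apply_iff (fun i => f i x) k t)
  refine sa_and (sa_fin_forall fun I => sa_imp ?_ (sa_finset_exists I fun i _ => ?_))
    (sa_fin_exists fun I => sa_and ?_ (sa_finset_forall I fun i _ => ?_))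
  · by_cases h : I.card = (k : ℕ) + 1 <;> simp [h]
  · simpa [Fin.init] using sa_le (n := m + 1) (Fin.last m) (Fin.castSucc i)
  · by_cases h : I.card = (k : ℕ) + 1 <;> simp [h]
  · simpa [Fin.init] using sa_le (n := m + 1) (Fin.castSucc i) (Fin.last m)

end FunctionsFromRelations

section BandSemialgebraic

open Literature.NumberTheory.Transcendental (IsSemialgebraicFunOn IsSemialgebraicMapOn
  isSemialgebraicFunOn_iff isSemialgebraicMapOn_iff_forall_holds)
open Literature.NumberTheory.Transcendental.SemialgebraicMonotonicity

/-- **The band homeomorphism is semialgebraic.** With semialgebraic `A`, `Φ` and nodes `v_k`,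
`w_k`, the band `{(x, s) : x ∈ A, v₀ x ≤ s ≤ v_q x}` is semialgebraic and the graph of
`Ψ_L (x, s) = (Φ x, λ_x(s))` over it is semialgebraic. [cite: Dries1998, Ch. 8 (2.8)]
[cite: BochnakCosteRoy1998, Prop. 2.2.6] -/
theorem band_isSemialgebraicMapOn {n q : ℕ} {A : Set (Fin n → ℝ)} (hA : IsSemialgebraic ℝ A)
    {Φ : (Fin n → ℝ) → (Fin n → ℝ)} (hΦ : IsSemialgebraicMapOn ℝ A Φ)
    {v w : Fin (q + 1) → (Fin n → ℝ) → ℝ} (hv : ∀ k, IsSemialgebraicFunOn ℝ A (v k))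
    (hw : ∀ k, IsSemialgebraicFunOn ℝ A (w k))
    {lam : (Fin n → ℝ) → ℝ → ℝ}
    (hlam : ∀ x s, lam x s = w 0 x + ∑ j : Fin q, (w j.succ x - w (Fin.castSucc j) x) *
      max 0 (min 1 ((s - v (Fin.castSucc j) x) / (v j.succ x - v (Fin.castSucc j) x))))
    {AG : Set (Fin (n + 1) → ℝ)}
    (hAG : ∀ z, z ∈ AG ↔ Fin.init z ∈ A ∧ v 0 (Fin.init z) ≤ z (Fin.last n) ∧
      z (Fin.last n) ≤ v (Fin.last q) (Fin.init z))
    {ΨL : (Fin (n + 1) → ℝ) → (Fin (n + 1) → ℝ)}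
    (hΨL : ∀ z, ΨL z = Fin.snoc (Φ (Fin.init z)) (lam (Fin.init z) (z (Fin.last n)))) :
    IsSemialgebraic ℝ AG ∧ IsSemialgebraicMapOn ℝ AG ΨL := by
  have hT : IsSemialgebraic ℝ {z : Fin (n + 1) → ℝ | Fin.init z ∈ A} := hA.setOf_init_mem
  have hAGs : IsSemialgebraic ℝ AG := by
    have h1 := (hv 0).isSemialgebraic_setOf_ge tarski_seidenberg_real_holds
    have h2 := (hv (Fin.last q)).isSemialgebraic_setOf_le tarski_seidenberg_real_holds
    convert h1.inter h2 using 1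
    ext z
    simp only [mem_inter_iff, mem_setOf_eq, hAG]
    tauto
  have hsub : AG ⊆ {z : Fin (n + 1) → ℝ | Fin.init z ∈ A} := fun z hz => ((hAG z).mp hz).1
  refine ⟨hAGs, IsSemialgebraicMapOn.of_forall hAGs fun j => ?_⟩
  refine Fin.lastCases ?_ (fun i => ?_) j
  · -- the fibre coordinate `λ_x(s)`
    have hxv : ∀ k, IsSemialgebraicFunOn ℝ {z : Fin (n + 1) → ℝ | Fin.init z ∈ A}
        (fun z => v k (Fin.init z)) := fun k => (hv k).comp_init
    have hxw : ∀ k, IsSemialgebraicFunOn ℝ {z : Fin (n + 1) → ℝ | Fin.init z ∈ A}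
        (fun z => w k (Fin.init z)) := fun k => (hw k).comp_init
    have hzl : IsSemialgebraicFunOn ℝ {z : Fin (n + 1) → ℝ | Fin.init z ∈ A}
        (fun z => z (Fin.last n)) := isSemialgebraicFunOn_apply hT (Fin.last n)
    have hstep : ∀ j' : Fin q, IsSemialgebraicFunOn ℝ {z : Fin (n + 1) → ℝ | Fin.init z ∈ A}
        (fun z => (w j'.succ (Fin.init z) - w (Fin.castSucc j') (Fin.init z)) *
          max 0 (min 1 ((z (Fin.last n) - v (Fin.castSucc j') (Fin.init z)) /
            (v j'.succ (Fin.init z) - v (Fin.castSucc j') (Fin.init z))))) := by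
      intro j'
      refine IsSemialgebraicFunOn.mul_holds (IsSemialgebraicFunOn.sub_holds (hxw _) (hxw _)) ?_
      refine IsSemialgebraicFunOn.max hT (isSemialgebraicFunOn_const' hT 0) ?_
      refine IsSemialgebraicFunOn.min hT (isSemialgebraicFunOn_const' hT 1) ?_
      exact IsSemialgebraicFunOn.div₀ hT (IsSemialgebraicFunOn.sub_holds hzl (hxv _))
        (IsSemialgebraicFunOn.sub_holds (hxv _) (hxv _))
    have htot := IsSemialgebraicFunOn.add_holds (hxw 0)
      (IsSemialgebraicFunOn.finset_sum hT Finset.univ fun j' _ => hstep j')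
    refine (htot.mono hsub hAGs).congr fun z _ => ?_
    simp only [hΨL, Fin.snoc_last, hlam, Pi.add_apply]
  · have hΦi : IsSemialgebraicFunOn ℝ A (fun x => Φ x i) :=
      (isSemialgebraicMapOn_iff_forall_holds hA).mp hΦ i
    refine ((hΦi.comp_init).mono hsub hAGs).congr fun z _ => ?_
    simp only [hΨL, Fin.snoc_castSucc]

end BandSemialgebraic

/-! ## The simplicial complex on the lifted band

[cite: Dries1998, Ch. 8 (2.7), (2.8)]: the closed set `L = K^F` between the least and greatest
height over `|K|` is a finite union of simplices compatible with the open cells "between /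
on the heights over an open simplex of `K`".  We obtain the complex from the sign-arrangement
engine `Literature.Analysis.Convexity.SignArrangement.chainComplex`, the arrangement consisting
of functionals detecting the open simplices of `K` (below) and of the functionals
`(p, t) ↦ t - A_{τ,i}(p)`, `A_{τ,i}` the affine form of the `i`-th height on the simplex `τ`. -/

section BandComplex

open Literature.Analysis.Convexity Literature.Analysis.Convexity.SignArrangement

/-- Evaluation of a finite sum of real affine functionals. [folklore] -/
theorem AffineMap.finset_sum_apply {V : Type*} [AddCommGroup V] [Module ℝ V] {α : Type*}
    (s : Finset α) (f : α → V →ᵃ[ℝ] ℝ) (p : V) : (∑ a ∈ s, f a) p = ∑ a ∈ s, f a p := by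
  classical
  induction s using Finset.induction_on with
  | empty => simp
  | insert a s ha ih => simp [Finset.sum_insert ha, ih]

/-- **Affine functionals detecting a simplex.** For an affinely independent finite set `τ` in
`ℝⁿ` there are affine functionals `β_v` (`v ∈ τ`; the barycentric coordinates on the affine
span), `γ_j` (`j < n`) and `δ` such that the closed simplex is `{β_v ≥ 0, γ_j = 0, δ = 0}` and
the open simplex is `{β_v > 0, γ_j = 0, δ = 0}`. [cite: Dries1998, Ch. 8 (1.4)] -/
theorem exists_affine_detect {n : ℕ} {τ : Finset (Fin n → ℝ)}
    (hτ : AffineIndependent ℝ ((↑) : τ → (Fin n → ℝ))) :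
    ∃ (β : (Fin n → ℝ) → (Fin n → ℝ) →ᵃ[ℝ] ℝ) (γ : Fin n → (Fin n → ℝ) →ᵃ[ℝ] ℝ)
      (δ : (Fin n → ℝ) →ᵃ[ℝ] ℝ),
      (∀ p, p ∈ convexHull ℝ (τ : Set (Fin n → ℝ)) ↔
        (∀ v ∈ τ, 0 ≤ β v p) ∧ (∀ j, γ j p = 0) ∧ δ p = 0) ∧
      (∀ p, p ∈ openSimplex ℝ τ ↔ (∀ v ∈ τ, 0 < β v p) ∧ (∀ j, γ j p = 0) ∧ δ p = 0) := by
  classical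
  let β : (Fin n → ℝ) → (Fin n → ℝ) →ᵃ[ℝ] ℝ := fun v =>
    interp τ hτ (fun y => if y = v then (1 : ℝ) else 0)
  let γ : Fin n → (Fin n → ℝ) →ᵃ[ℝ] ℝ := fun j =>
    (LinearMap.proj j : (Fin n → ℝ) →ₗ[ℝ] ℝ).toAffineMap - ∑ v ∈ τ, (v j) • β v
  let δ : (Fin n → ℝ) →ᵃ[ℝ] ℝ := ∑ v ∈ τ, β v - AffineMap.const ℝ (Fin n → ℝ) (1 : ℝ)
  -- values on convex combinations of the vertices
  have hβ : ∀ (w : (Fin n → ℝ) → ℝ), ∑ y ∈ τ, w y = 1 → ∀ v ∈ τ,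
      β v (∑ y ∈ τ, w y • y) = w v := by
    intro w hw1 v hv
    rw [affineMap_apply_sum_smul (g := β v) (fun y _ => rfl) hw1]
    simp only [β, smul_eq_mul]
    rw [Finset.sum_congr rfl fun y hy => by rw [interp_apply_of_mem hτ _ hy]]
    simp [Finset.sum_ite_eq', hv]
  have hγ_apply : ∀ j p, γ j p = p j - ∑ v ∈ τ, v j * β v p := by
    intro j p
    simp only [γ, AffineMap.coe_sub, Pi.sub_apply, LinearMap.coe_toAffineMap, LinearMap.coe_proj,
      Function.eval, AffineMap.finset_sum_apply, AffineMap.coe_smul, Pi.smul_apply, smul_eq_mul]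
  have hδ_apply : ∀ p, δ p = ∑ v ∈ τ, β v p - 1 := by
    intro p
    simp only [δ, AffineMap.coe_sub, Pi.sub_apply, AffineMap.finset_sum_apply,
      AffineMap.const_apply]
  have hsum_apply : ∀ (c : (Fin n → ℝ) → ℝ) (j : Fin n),
      (∑ v ∈ τ, c v • v) j = ∑ v ∈ τ, v j * c v := by
    intro c j
    rw [Finset.sum_apply]
    exact Finset.sum_congr rfl fun v _ => by simp [mul_comm]
  have hγ : ∀ (w : (Fin n → ℝ) → ℝ), ∑ y ∈ τ, w y = 1 → ∀ j, γ j (∑ y ∈ τ, w y • y) = 0 := by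
    intro w hw1 j
    rw [hγ_apply, hsum_apply, sub_eq_zero]
    exact (Finset.sum_congr rfl fun v hv => by rw [hβ w hw1 v hv]).symm
  have hδ : ∀ (w : (Fin n → ℝ) → ℝ), ∑ y ∈ τ, w y = 1 → δ (∑ y ∈ τ, w y • y) = 0 := by
    intro w hw1
    rw [hδ_apply, Finset.sum_congr rfl fun v hv => hβ w hw1 v hv, hw1, sub_self]
  -- conversely the three conditions exhibit `p` as a convex combination with weights `β v p`
  have hrepr : ∀ p, (∀ j, γ j p = 0) → δ p = 0 →
      ∑ v ∈ τ, β v p = 1 ∧ ∑ v ∈ τ, β v p • v = p := by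
    intro p hγp hδp
    have h1 : ∑ v ∈ τ, β v p = 1 := by
      rw [hδ_apply, sub_eq_zero] at hδp
      exact hδp
    refine ⟨h1, funext fun j => ?_⟩
    have h := hγp j
    rw [hγ_apply, sub_eq_zero] at h
    rw [hsum_apply, ← h]
  refine ⟨β, γ, δ, fun p => ⟨fun hp => ?_, fun ⟨hb, hg, hd⟩ => ?_⟩,
    fun p => ⟨fun hp => ?_, fun ⟨hb, hg, hd⟩ => ?_⟩⟩
  · obtain ⟨w, hw0, hw1, rfl⟩ := Finset.mem_convexHull'.1 hp
    exact ⟨fun v hv => by rw [hβ w hw1 v hv]; exact hw0 v hv, hγ w hw1, hδ w hw1⟩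
  · obtain ⟨h1, hp⟩ := hrepr p hg hd
    rw [← hp]
    exact Finset.mem_convexHull'.2 ⟨fun v => β v p, hb, h1, rfl⟩
  · obtain ⟨w, hw0, hw1, rfl⟩ := hp
    exact ⟨fun v hv => by rw [hβ w hw1 v hv]; exact hw0 v hv, hγ w hw1, hδ w hw1⟩
  · obtain ⟨h1, hp⟩ := hrepr p hg hd
    exact ⟨fun v => β v p, hb, h1, hp⟩

/-- The open simplex of a chain simplex lies in the face of the greatest element of the chain
(all the weights being positive, `sum_smul_mem_face`). [folklore] -/
theorem openSimplex_image_subset_face {V : Type*} [AddCommGroup V] [Module ℝ V] [DecidableEq V]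
    {ι : Type*} [DecidableEq ι] {L : ι → V →ᵃ[ℝ] ℝ} {Φ : Finset (ι → SignType)}
    {b : (ι → SignType) → V} (hb : ∀ ε ∈ Φ, b ε ∈ face L ε) {C : Finset (ι → SignType)}
    (hCΦ : C ⊆ Φ) {F : ι → SignType} (hF : F ∈ C) (hmax : ∀ G ∈ C, SLE G F) :
    openSimplex ℝ (C.image b) ⊆ face L F := by
  rintro x ⟨w, hw0, hw1, rfl⟩
  have hinj : Set.InjOn b C := fun G hG G' hG' h => by
    have h1 : svec L (b G) = G := hb G (hCΦ hG)
    have h2 : svec L (b G') = G' := hb G' (hCΦ hG')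
    rw [← h1, ← h2, h]
  rw [Finset.sum_image hinj]
  refine sum_smul_mem_face hb hCΦ hF hmax (fun G hG => hw0 _ (Finset.mem_image_of_mem b hG)) ?_
  rw [← Finset.sum_image hinj (g := b) (f := w)]
  exact hw1

/-- **The complex on the lifted band** [cite: Dries1998, Ch. 8 (2.7)–(2.8)]. Let `K` be a
finite complex in `ℝⁿ` and `ℓ₀, …, ℓ_q` functions on `ℝⁿ` which are affine on every closed
simplex of `K` (the heights).  Then the closed band
`Λ = {(p, t) : p ∈ |K|, minᵢ ℓᵢ p ≤ t ≤ maxᵢ ℓᵢ p}` is the polyhedron of a finite simplicial complex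
each of whose open simplices lies over a single open simplex of `K` and on a constant side of
every height. -/
theorem exists_simplicialComplex_band {n q : ℕ} (K : Geometry.SimplicialComplex ℝ (Fin n → ℝ))
    (hK : K.faces.Finite) (ℓ : Fin (q + 1) → (Fin n → ℝ) → ℝ)
    (hℓ : ∀ i, ∀ τ ∈ K.faces, ∃ A : (Fin n → ℝ) →ᵃ[ℝ] ℝ,
      EqOn (ℓ i) A (convexHull ℝ (τ : Set (Fin n → ℝ)))) :
    ∃ Lc : Geometry.SimplicialComplex ℝ (Fin (n + 1) → ℝ), Lc.faces.Finite ∧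
      Lc.space = {z | (Fin.init z : Fin n → ℝ) ∈ K.space ∧
        (∃ i, ℓ i (Fin.init z) ≤ z (Fin.last n)) ∧ ∃ i, z (Fin.last n) ≤ ℓ i (Fin.init z)} ∧
      ∀ σ ∈ Lc.faces, ∃ τ ∈ K.faces, ∃ ε : Fin (q + 1) → SignType, ∀ z ∈ openSimplex ℝ σ,
        (Fin.init z : Fin n → ℝ) ∈ openSimplex ℝ τ ∧
          ∀ i, SignType.sign (z (Fin.last n) - ℓ i (Fin.init z)) = ε i := by
  classical
  set Λ : Set (Fin (n + 1) → ℝ) := {z | (Fin.init z : Fin n → ℝ) ∈ K.space ∧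
    (∃ i, ℓ i (Fin.init z) ≤ z (Fin.last n)) ∧ ∃ i, z (Fin.last n) ≤ ℓ i (Fin.init z)} with hΛ
  haveI : Fintype K.faces := hK.fintype
  -- affine data: detecting functionals of the simplices, affine forms of the heights
  choose β γ δ hconv hopen using fun τ : K.faces => exists_affine_detect (K.indep τ.2)
  choose A hA using hℓ
  set Vset : Finset (Fin n → ℝ) := hK.toFinset.biUnion id with hVset_def
  have hVset : ∀ τ ∈ K.faces, ∀ v ∈ τ, v ∈ Vset := fun τ hτ v hv =>
    Finset.mem_biUnion.mpr ⟨τ, hK.mem_toFinset.mpr hτ, hv⟩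
  -- the arrangement
  let initA : (Fin (n + 1) → ℝ) →ᵃ[ℝ] (Fin n → ℝ) :=
    (LinearMap.funLeft ℝ ℝ (Fin.castSucc : Fin n → Fin (n + 1))).toAffineMap
  let lastA : (Fin (n + 1) → ℝ) →ᵃ[ℝ] ℝ :=
    (LinearMap.proj (Fin.last n) : (Fin (n + 1) → ℝ) →ₗ[ℝ] ℝ).toAffineMap
  let L : (K.faces × (Vset ⊕ Fin n ⊕ Unit)) ⊕ (K.faces × Fin (q + 1)) →
      (Fin (n + 1) → ℝ) →ᵃ[ℝ] ℝ := Sum.elim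
    (fun a => Sum.elim (fun v : Vset => (β a.1 (v : Fin n → ℝ)).comp initA)
      (Sum.elim (fun j => (γ a.1 j).comp initA) (fun _ => (δ a.1).comp initA)) a.2)
    (fun a => lastA - (A a.2 a.1.1 a.1.2).comp initA)
  have hLβ : ∀ (τ : K.faces) (v : Vset) (z : Fin (n + 1) → ℝ),
      L (Sum.inl (τ, Sum.inl v)) z = β τ v (Fin.init z) := fun _ _ _ => rfl
  have hLγ : ∀ (τ : K.faces) (j : Fin n) (z : Fin (n + 1) → ℝ),
      L (Sum.inl (τ, Sum.inr (Sum.inl j))) z = γ τ j (Fin.init z) := fun _ _ _ => rfl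
  have hLδ : ∀ (τ : K.faces) (z : Fin (n + 1) → ℝ),
      L (Sum.inl (τ, Sum.inr (Sum.inr ()))) z = δ τ (Fin.init z) := fun _ _ => rfl
  have hLA : ∀ (τ : K.faces) (i : Fin (q + 1)) (z : Fin (n + 1) → ℝ),
      L (Sum.inr (τ, i)) z = z (Fin.last n) - A i τ.1 τ.2 (Fin.init z) := fun _ _ _ => rfl
  -- sign vectors decide the carrier simplex and the side of each height
  have hdet : ∀ z z' : Fin (n + 1) → ℝ, svec L z = svec L z' → ∀ τ : K.faces,
      (Fin.init z ∈ openSimplex ℝ τ.1 → Fin.init z' ∈ openSimplex ℝ τ.1) ∧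
      ∀ i, SignType.sign (z (Fin.last n) - A i τ.1 τ.2 (Fin.init z)) =
        SignType.sign (z' (Fin.last n) - A i τ.1 τ.2 (Fin.init z')) := by
    intro z z' hzz' τ
    have hs : ∀ k, SignType.sign (L k z) = SignType.sign (L k z') := fun k => congr_fun hzz' k
    constructor
    · intro hz
      rw [hopen τ] at hz ⊢
      obtain ⟨hb, hg, hd⟩ := hz
      refine ⟨fun v hv => ?_, fun j => ?_, ?_⟩
      · have h := hs (Sum.inl (τ, Sum.inl ⟨v, hVset τ.1 τ.2 v hv⟩))
        rw [hLβ, hLβ] at h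
        have h' := hb v hv
        rw [← sign_eq_one_iff] at h' ⊢
        rw [← h]
        exact h'
      · have h := hs (Sum.inl (τ, Sum.inr (Sum.inl j)))
        rw [hLγ, hLγ] at h
        have h' := hg j
        rw [← sign_eq_zero_iff] at h' ⊢
        rw [← h]
        exact h'
      · have h := hs (Sum.inl (τ, Sum.inr (Sum.inr ())))
        rw [hLδ, hLδ] at h
        rw [← sign_eq_zero_iff] at hd ⊢
        rw [← h]
        exact hd
    · intro i
      have h := hs (Sum.inr (τ, i))
      rwa [hLA, hLA] at h
  have hcarrier : ∀ p ∈ K.space, ∃ τ : K.faces, p ∈ openSimplex ℝ τ.1 := fun p hp => by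
    obtain ⟨τ, hτ, hp⟩ := exists_mem_openSimplex_of_mem_space hp
    exact ⟨⟨τ, hτ⟩, hp⟩
  have hℓA : ∀ (τ : K.faces) (i), ∀ p ∈ openSimplex ℝ τ.1, ℓ i p = A i τ.1 τ.2 p :=
    fun τ i p hp => hA i τ.1 τ.2 (openSimplex_subset_convexHull (𝕜 := ℝ) _ hp)
  -- `Λ` is a union of faces of the arrangement
  have hΛface : ∀ z ∈ Λ, ∀ z', svec L z = svec L z' → z' ∈ Λ := by
    intro z hz z' hzz'
    obtain ⟨hzK, ⟨i, hi⟩, ⟨j, hj⟩⟩ := hz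
    obtain ⟨τ, hzτ⟩ := hcarrier _ hzK
    have hz'τ := (hdet z z' hzz' τ).1 hzτ
    refine ⟨openSimplex_subset_space τ.2 hz'τ, ⟨i, ?_⟩, ⟨j, ?_⟩⟩
    · have h := (hdet z z' hzz' τ).2 i
      rw [hℓA τ i _ hzτ, ← sub_nonneg, ← sign_nonneg_iff] at hi
      rw [hℓA τ i _ hz'τ, ← sub_nonneg, ← sign_nonneg_iff, ← h]
      exact hi
    · have h := (hdet z z' hzz' τ).2 j
      rw [hℓA τ j _ hzτ, ← sub_nonpos, ← sign_nonpos_iff] at hj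
      rw [hℓA τ j _ hz'τ, ← sub_nonpos, ← sign_nonpos_iff, ← h]
      exact hj
  -- `Λ` is closed and bounded
  have hcont : ∀ i, ContinuousOn (ℓ i) K.space := fun i =>
    continuousOn_space_of_forall hK fun τ hτ =>
      (A i τ hτ).continuous_of_finiteDimensional.continuousOn.congr (hA i τ hτ)
  have hKc : IsClosed K.space := isClosed_space_of_finite hK
  have hΛclosed : IsClosed Λ := by
    have hπ : Continuous fun z : Fin (n + 1) → ℝ => (Fin.init z, z (Fin.last n)) :=
      continuous_id.finInit.prodMk (continuous_apply _)
    have h1 : ∀ i, IsClosed {z : Fin (n + 1) → ℝ |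
        Fin.init z ∈ K.space ∧ ℓ i (Fin.init z) ≤ z (Fin.last n)} :=
      fun i => (hKc.epigraph (hcont i)).preimage hπ
    have h2 : ∀ i, IsClosed {z : Fin (n + 1) → ℝ |
        Fin.init z ∈ K.space ∧ z (Fin.last n) ≤ ℓ i (Fin.init z)} :=
      fun i => (hKc.hypograph (hcont i)).preimage hπ
    have hΛeq : Λ = (⋃ i, {z : Fin (n + 1) → ℝ |
        Fin.init z ∈ K.space ∧ ℓ i (Fin.init z) ≤ z (Fin.last n)}) ∩
        ⋃ i, {z : Fin (n + 1) → ℝ | Fin.init z ∈ K.space ∧ z (Fin.last n) ≤ ℓ i (Fin.init z)} := by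
      ext z
      simp only [hΛ, mem_setOf_eq, mem_inter_iff, mem_iUnion]
      constructor
      · rintro ⟨hK', ⟨i, hi⟩, ⟨j, hj⟩⟩
        exact ⟨⟨i, hK', hi⟩, ⟨j, hK', hj⟩⟩
      · rintro ⟨⟨i, hK', hi⟩, ⟨j, -, hj⟩⟩
        exact ⟨hK', ⟨i, hi⟩, ⟨j, hj⟩⟩
    rw [hΛeq]
    exact (isClosed_iUnion_of_finite h1).inter (isClosed_iUnion_of_finite h2)
  have hbdd : Bornology.IsBounded Λ := by
    obtain ⟨R, hR⟩ := (isCompact_space_of_finite hK).isBounded.exists_norm_le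
    have hb : ∀ i, ∃ C, ∀ p ∈ K.space, ‖ℓ i p‖ ≤ C := fun i =>
      (isCompact_space_of_finite hK).exists_bound_of_continuousOn (hcont i)
    choose C hC using hb
    have hCle : ∀ i, C i ≤ ∑ k, |C k| := fun i =>
      (le_abs_self _).trans (Finset.single_le_sum (fun k _ => abs_nonneg (C k)) (Finset.mem_univ i))
    have hR0 : 0 ≤ max R (∑ k, |C k|) :=
      le_max_of_le_right (Finset.sum_nonneg fun k _ => abs_nonneg (C k))
    refine (Metric.isBounded_closedBall (x := (0 : Fin (n + 1) → ℝ))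
      (r := max R (∑ k, |C k|))).subset fun z hz => ?_
    obtain ⟨hzK, ⟨i, hi⟩, ⟨j, hj⟩⟩ := hz
    rw [mem_closedBall_zero_iff, pi_norm_le_iff_of_nonneg hR0]
    intro l
    refine Fin.lastCases ?_ (fun l' => ?_) l
    · have h1 := hC i _ hzK
      have h2 := hC j _ hzK
      rw [Real.norm_eq_abs, abs_le] at h1 h2 ⊢
      constructor
      · calc -(max R (∑ k, |C k|)) ≤ -(∑ k, |C k|) := neg_le_neg (le_max_right _ _)
          _ ≤ -C i := neg_le_neg (hCle i)
          _ ≤ ℓ i (Fin.init z) := h1.1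
          _ ≤ z (Fin.last n) := hi
      · calc z (Fin.last n) ≤ ℓ j (Fin.init z) := hj
          _ ≤ C j := h2.2
          _ ≤ ∑ k, |C k| := hCle j
          _ ≤ max R (∑ k, |C k|) := le_max_right _ _
    · calc ‖z (Fin.castSucc l')‖ = ‖Fin.init z l'‖ := rfl
        _ ≤ ‖Fin.init z‖ := norm_le_pi_norm _ _
        _ ≤ R := hR _ hzK
        _ ≤ max R (∑ k, |C k|) := le_max_left _ _
  -- the faces meeting `Λ` and their chosen points
  set Φs : Finset ((K.faces × (Vset ⊕ Fin n ⊕ Unit)) ⊕ (K.faces × Fin (q + 1)) → SignType) :=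
    Finset.univ.filter fun ε => (face L ε ∩ Λ).Nonempty with hΦs_def
  have hmemΦ : ∀ ε, ε ∈ Φs ↔ (face L ε ∩ Λ).Nonempty := fun ε => by simp [hΦs_def]
  have hb' : ∀ ε ∈ Φs, ∃ x, x ∈ face L ε ∧ x ∈ Λ := fun ε hε => (hmemΦ ε).mp hε
  choose! b hbface hbΛ using hb'
  have hfaceΛ : ∀ ε ∈ Φs, face L ε ⊆ Λ := fun ε hε x hx =>
    hΛface (b ε) (hbΛ ε hε) x ((hbface ε hε).trans (mem_face_iff.mp hx).symm)
  have hclΛ : ∀ ε ∈ Φs, cl L ε ⊆ Λ := fun ε hε =>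
    (cl_subset_closure_face (hbface ε hε)).trans (closure_minimal (hfaceΛ ε hε) hΛclosed)
  have hdown : ∀ ε ∈ Φs, ∀ ε', SLE ε' ε → (face L ε').Nonempty → ε' ∈ Φs := by
    intro ε hε ε' hle hne
    obtain ⟨x, hx⟩ := hne
    refine (hmemΦ ε').mpr ⟨x, hx, hclΛ ε hε ?_⟩
    rw [mem_cl_iff_sle, mem_face_iff.mp hx]
    exact hle
  have hbdd' : ∀ ε ∈ Φs, Bornology.IsBounded (cl L ε) := fun ε hε => hbdd.subset (hclΛ ε hε)
  -- the chain complex of the arrangement on `Φs`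
  refine ⟨chainComplex L Φs b hbface, chainComplex_faces_finite, ?_, ?_⟩
  · apply Subset.antisymm
    · intro z hz
      obtain ⟨ε, hε, hzε⟩ := mem_iUnion₂.mp (chainComplex_space_subset hz)
      exact hclΛ ε hε hzε
    · intro z hz
      have hε : svec L z ∈ Φs := (hmemΦ _).mpr ⟨z, mem_face_svec z, hz⟩
      exact face_subset_chainComplex_space hdown hbdd' hε (mem_face_svec z)
  · intro σ hσ
    obtain ⟨C, hCΦ, hCne, hC, rfl⟩ := mem_chainComplex_faces.mp hσ
    obtain ⟨F, hF, hmax⟩ := exists_max_of_isChain hC hCne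
    have hFΦ : F ∈ Φs := hCΦ hF
    have hface : openSimplex ℝ (C.image b) ⊆ face L F :=
      openSimplex_image_subset_face hbface hCΦ hF hmax
    obtain ⟨τ, hτ⟩ := hcarrier _ (hbΛ F hFΦ).1
    refine ⟨τ.1, τ.2, fun i => SignType.sign (b F (Fin.last n) - A i τ.1 τ.2 (Fin.init (b F))),
      fun z hz => ?_⟩
    have hzz : svec L (b F) = svec L z := (hbface F hFΦ).trans (mem_face_iff.mp (hface hz)).symm
    obtain ⟨h1, h2⟩ := hdet _ _ hzz τ
    have hzτ := h1 hτ
    refine ⟨hzτ, fun i => ?_⟩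
    rw [hℓA τ i _ hzτ]
    exact (h2 i).symm

end BandComplex

/-! ## Ingredients of the lifting theorem

Semialgebraicity of affine functionals, closed and open simplices, preimages under semialgebraic
maps and piecewise-defined functions; refinement of open simplices under barycentric subdivision;
sign compatibility of the PL fibre interpolant. -/

section LiftingIngredients

open Literature.NumberTheory.Transcendental (IsSemialgebraicFunOn IsSemialgebraicMapOn
  isSemialgebraicFunOn_iff isSemialgebraicMapOn_iff isSemialgebraicFunOn_aeval)
open Literature.NumberTheory.Transcendental.SemialgebraicMonotonicity
open Literature.Analysis.Convexity

variable {n : ℕ}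

/-- Real affine functionals are semialgebraic functions. [cite: BochnakCosteRoy1998, §2.2] -/
theorem AffineMap.isSemialgebraicFunOn (F : (Fin n → ℝ) →ᵃ[ℝ] ℝ) {s : Set (Fin n → ℝ)}
    (hs : IsSemialgebraic ℝ s) : IsSemialgebraicFunOn ℝ s F :=
  (isSemialgebraicFunOn_aeval hs (affinePoly F.linear (F 0))).congr fun x _ => by
    show MvPolynomial.aeval x (affinePoly F.linear (F 0)) = F x
    rw [aeval_affinePoly, congr_fun F.decomp x]
    rfl

/-- `{0 ≤ F}` is semialgebraic for a real affine functional `F`. [cite: BochnakCosteRoy1998, §2.1] -/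
theorem AffineMap.isSemialgebraic_setOf_nonneg (F : (Fin n → ℝ) →ᵃ[ℝ] ℝ) :
    IsSemialgebraic ℝ {x | 0 ≤ F x} := by
  convert isSemialgebraic_setOf_affine_nonneg F.linear (F 0) using 1
  ext x
  rw [mem_setOf_eq, mem_setOf_eq, congr_fun F.decomp x]
  rfl

/-- `{F = 0}` is semialgebraic for a real affine functional `F`. [cite: BochnakCosteRoy1998, §2.1] -/
theorem AffineMap.isSemialgebraic_setOf_eq_zero (F : (Fin n → ℝ) →ᵃ[ℝ] ℝ) :
    IsSemialgebraic ℝ {x | F x = 0} := by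
  convert isSemialgebraic_setOf_affine_eq_zero F.linear (F 0) using 1
  ext x
  rw [mem_setOf_eq, mem_setOf_eq, congr_fun F.decomp x]
  rfl

/-- `{0 < F}` is semialgebraic for a real affine functional `F`. [cite: BochnakCosteRoy1998, §2.1] -/
theorem AffineMap.isSemialgebraic_setOf_pos (F : (Fin n → ℝ) →ᵃ[ℝ] ℝ) :
    IsSemialgebraic ℝ {x | 0 < F x} := by
  convert (AffineMap.isSemialgebraic_setOf_nonneg (-F)).compl using 1
  ext x
  simp [not_le]

/-- Closed simplices are semialgebraic. [cite: BochnakCosteRoy1998, §2.1] -/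
theorem isSemialgebraic_convexHull_of_affineIndependent' {τ : Finset (Fin n → ℝ)}
    (hτ : AffineIndependent ℝ ((↑) : τ → (Fin n → ℝ))) :
    IsSemialgebraic ℝ (convexHull ℝ (τ : Set (Fin n → ℝ))) := by
  obtain ⟨β, γ, δ, hconv, -⟩ := exists_affine_detect hτ
  have h : convexHull ℝ (τ : Set (Fin n → ℝ)) =
      {p | ∀ v ∈ τ, 0 ≤ β v p} ∩ ({p | ∀ j, γ j p = 0} ∩ {p | δ p = 0}) := by
    ext p
    simp only [hconv, mem_inter_iff, mem_setOf_eq]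
  rw [h]
  exact (sa_finset_forall τ fun v _ => AffineMap.isSemialgebraic_setOf_nonneg (β v)).inter
    ((sa_fin_forall fun j => AffineMap.isSemialgebraic_setOf_eq_zero (γ j)).inter
      (AffineMap.isSemialgebraic_setOf_eq_zero δ))

/-- Open simplices are semialgebraic. [cite: BochnakCosteRoy1998, §2.1] -/
theorem isSemialgebraic_openSimplex {τ : Finset (Fin n → ℝ)}
    (hτ : AffineIndependent ℝ ((↑) : τ → (Fin n → ℝ))) :
    IsSemialgebraic ℝ (openSimplex ℝ τ) := by
  obtain ⟨β, γ, δ, -, hopen⟩ := exists_affine_detect hτ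
  have h : openSimplex ℝ τ =
      {p | ∀ v ∈ τ, 0 < β v p} ∩ ({p | ∀ j, γ j p = 0} ∩ {p | δ p = 0}) := by
    ext p
    simp only [hopen, mem_inter_iff, mem_setOf_eq]
  rw [h]
  exact (sa_finset_forall τ fun v _ => AffineMap.isSemialgebraic_setOf_pos (β v)).inter
    ((sa_fin_forall fun j => AffineMap.isSemialgebraic_setOf_eq_zero (γ j)).inter
      (AffineMap.isSemialgebraic_setOf_eq_zero δ))

/-- **Preimages under semialgebraic maps**: `{x ∈ s | f x ∈ T}` is semialgebraic for a
semialgebraic map `f` on `s` and a semialgebraic `T` (projection of `graph f ∩ (ℝᵐ × T)`).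
[cite: BochnakCosteRoy1998, Prop. 2.2.7] -/
theorem IsSemialgebraicMapOn.isSemialgebraic_sep_mem {m l : ℕ} {s : Set (Fin m → ℝ)}
    {f : (Fin m → ℝ) → (Fin l → ℝ)} (hf : IsSemialgebraicMapOn ℝ s f) {T : Set (Fin l → ℝ)}
    (hT : IsSemialgebraic ℝ T) : IsSemialgebraic ℝ {x | x ∈ s ∧ f x ∈ T} := by
  have hΓ : IsSemialgebraic ℝ {z : Fin (m + l) → ℝ | ∃ x ∈ s, z = Fin.append x (f x)} := hf
  have key : IsSemialgebraic ℝ {w : Fin (m + l) → ℝ |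
      (∃ x ∈ s, (Fin.append (fun i => w (Fin.castAdd l i)) (fun j => w (Fin.natAdd m j)) :
        Fin (m + l) → ℝ) = Fin.append x (f x)) ∧ (fun j => w (Fin.natAdd m j)) ∈ T} := by
    refine IsSemialgebraic.inter ?_ (hT.preimage_comp (Fin.natAdd m))
    convert hΓ using 2 with w
    rw [Fin.append_castAdd_natAdd]
    rfl
  have hex := sa_exists_block (m := m) (n := l)
    (P := fun x y => (∃ x' ∈ s, (Fin.append x y : Fin (m + l) → ℝ) = Fin.append x' (f x')) ∧ y ∈ T)
    key
  convert hex using 1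
  ext x
  simp only [mem_setOf_eq]
  constructor
  · rintro ⟨hx, hfx⟩
    exact ⟨f x, ⟨x, hx, rfl⟩, hfx⟩
  · rintro ⟨y, ⟨x', hx', hxy⟩, hy⟩
    have hx : x = x' := funext fun i => by
      have h := congr_fun hxy (Fin.castAdd l i)
      simpa only [Fin.append_left] using h
    have hy' : y = f x' := funext fun j => by
      have h := congr_fun hxy (Fin.natAdd m j)
      simpa only [Fin.append_right] using h
    subst hx
    exact ⟨hx', hy' ▸ hy⟩

/-- **Piecewise semialgebraic functions**: a function which on each member of a finite cover of
`s` by semialgebraic sets agrees with a semialgebraic function is semialgebraic on `s`.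
[cite: BochnakCosteRoy1998, §2.2] -/
theorem IsSemialgebraicFunOn.of_finset_cover {ι : Type*} {s : Set (Fin n → ℝ)} (I : Finset ι)
    (B : ι → Set (Fin n → ℝ)) (hcover : s = ⋃ i ∈ I, B i) {F : (Fin n → ℝ) → ℝ}
    (hF : ∀ i ∈ I, IsSemialgebraicFunOn ℝ (B i) F) : IsSemialgebraicFunOn ℝ s F := by
  rw [isSemialgebraicFunOn_iff]
  have h := IsSemialgebraic.biUnion (k := ℝ) I
    (fun i => {v : Fin (n + 1) → ℝ | Fin.init v ∈ B i ∧ v (Fin.last n) = F (Fin.init v)})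
    fun i hi => isSemialgebraicFunOn_iff.mp (hF i hi)
  convert h using 1
  ext v
  simp only [hcover, mem_setOf_eq, mem_iUnion, exists_and_right, exists_prop]

/-- **Open simplices of the barycentric subdivision refine those of the complex**, and contain
the barycentre of the carrier among their vertices. [cite: Dries1998, Ch. 8 (1.8)] -/
theorem exists_openSimplex_sd_subset {E : Type*} [NormedAddCommGroup E] [NormedSpace ℝ E]
    [DecidableEq E] {K : Geometry.SimplicialComplex ℝ E} {σ : Finset E} (hσ : σ ∈ (sd K).faces) :
    ∃ τ ∈ K.faces, bary τ ∈ σ ∧ openSimplex ℝ σ ⊆ openSimplex ℝ τ := by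
  obtain ⟨C, hCne, hCK, hC, rfl⟩ := mem_sd_iff.mp hσ
  obtain ⟨F, hF, hmax⟩ := Literature.Analysis.Convexity.exists_max_of_isChain hC hCne
  refine ⟨F, hCK F hF, Finset.mem_image_of_mem _ hF, ?_⟩
  rintro x ⟨w, hw0, hw1, rfl⟩
  have hinj : Set.InjOn (bary : Finset E → E) C := fun G hG G' hG' h =>
    bary_injOn (hCK G hG) (hCK G' hG') h
  rw [Finset.sum_image hinj, openSimplex_eq_relInt (K.indep (hCK F hF))]
  refine sum_smul_bary_mem_relInt hCK hF hmax (fun G hG => hw0 _ (Finset.mem_image_of_mem _ hG)) ?_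
  rw [← Finset.sum_image hinj (g := bary) (f := w)]
  exact hw1

/-- Comparability of sections on the cells of `K` passes to the cells of `sd K`, where in
addition condition `(*)` of [Dries1998, Ch. 8 (2.8)] holds: two sections agreeing at all vertices
of a cell of `sd K` agree on the cell (the barycentre of the carrier is a vertex).
[cite: Dries1998, Ch. 8 (2.8), first paragraph of the proof] -/
theorem sd_comparable_and_star {E : Type*} [NormedAddCommGroup E] [NormedSpace ℝ E]
    [DecidableEq E] {K : Geometry.SimplicialComplex ℝ E} {β : Type*} {g : β → E → ℝ}
    (hcomp : ∀ τ ∈ K.faces, ∀ i j, (∀ p ∈ openSimplex ℝ τ, g i p < g j p) ∨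
      (∀ p ∈ openSimplex ℝ τ, g i p = g j p) ∨ (∀ p ∈ openSimplex ℝ τ, g j p < g i p)) :
    (∀ σ ∈ (sd K).faces, ∀ i j, (∀ p ∈ openSimplex ℝ σ, g i p < g j p) ∨
      (∀ p ∈ openSimplex ℝ σ, g i p = g j p) ∨ (∀ p ∈ openSimplex ℝ σ, g j p < g i p)) ∧
    ∀ σ ∈ (sd K).faces, ∀ i j, (∀ v ∈ σ, g i v = g j v) →
      ∀ p ∈ openSimplex ℝ σ, g i p = g j p := by
  constructor
  · intro σ hσ i j
    obtain ⟨τ, hτ, -, hsub⟩ := exists_openSimplex_sd_subset hσ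
    rcases hcomp τ hτ i j with h | h | h
    · exact Or.inl fun p hp => h p (hsub hp)
    · exact Or.inr (Or.inl fun p hp => h p (hsub hp))
    · exact Or.inr (Or.inr fun p hp => h p (hsub hp))
  · intro σ hσ i j hv p hp
    obtain ⟨τ, hτ, hbσ, hsub⟩ := exists_openSimplex_sd_subset hσ
    have hb : bary τ ∈ openSimplex ℝ τ := by
      rw [openSimplex_eq_relInt (K.indep hτ)]
      exact bary_mem_relInt (K.indep hτ) (K.nonempty_of_mem_faces hτ)
    have hvb := hv _ hbσ
    rcases hcomp τ hτ i j with h | h | h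
    · exact absurd hvb (h _ hb).ne
    · exact h p (hsub hp)
    · exact absurd hvb (h _ hb).ne'

variable {X : Type*}

/-- **Sign compatibility of the PL fibre interpolant**: on `[v₀ x, v_q x]` the interpolant lies on
the same side of the target node `w_k x` as its argument lies of the source node `v_k x`.
[folklore] -/
theorem plInterpolant_sign {q : ℕ} {v w : Fin (q + 1) → X → ℝ}
    (hmono : ∀ x, Monotone fun j => v j x) (hmonow : ∀ x, Monotone fun j => w j x)
    (htie : ∀ (j : Fin q) x, v (Fin.castSucc j) x = v j.succ x → w (Fin.castSucc j) x = w j.succ x)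
    (htie' : ∀ (j : Fin q) x, w (Fin.castSucc j) x = w j.succ x → v (Fin.castSucc j) x = v j.succ x)
    (x : X) {s : ℝ} (hs : s ∈ Icc (v 0 x) (v (Fin.last q) x)) (k : Fin (q + 1)) :
    SignType.sign (w 0 x + ∑ j : Fin q, (w j.succ x - w (Fin.castSucc j) x) *
      max 0 (min 1 ((s - v (Fin.castSucc j) x) / (v j.succ x - v (Fin.castSucc j) x))) - w k x) =
      SignType.sign (s - v k x) := by
  set lam : ℝ → ℝ := fun s => w 0 x + ∑ j : Fin q, (w j.succ x - w (Fin.castSucc j) x) *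
      max 0 (min 1 ((s - v (Fin.castSucc j) x) / (v j.succ x - v (Fin.castSucc j) x))) with hlam
  have hm : Monotone lam := plInterpolant_monotone (v := v) (w := w) hmono hmonow x
  have hnode : lam (v k x) = w k x := plInterpolant_apply_node (v := v) (w := w) hmono htie x k
  have hk : v k x ∈ Icc (v 0 x) (v (Fin.last q) x) := ⟨hmono x (Fin.zero_le _), hmono x (Fin.le_last _)⟩
  have hinj : ∀ s₁ ∈ Icc (v 0 x) (v (Fin.last q) x), ∀ s₂ ∈ Icc (v 0 x) (v (Fin.last q) x),
      lam s₁ = lam s₂ → s₁ = s₂ := by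
    intro s₁ h₁ s₂ h₂ h
    have e₁ := plInterpolant_inverse (v := v) (w := w) hmono hmonow htie htie' x h₁
    have e₂ := plInterpolant_inverse (v := v) (w := w) hmono hmonow htie htie' x h₂
    simp only at e₁ e₂
    simp only [hlam] at h
    rw [h] at e₁
    exact e₁.symm.trans e₂
  show SignType.sign (lam s - w k x) = SignType.sign (s - v k x)
  rcases lt_trichotomy s (v k x) with hlt | heq | hgt
  · have hle : lam s ≤ w k x := hnode ▸ hm hlt.le
    have hne : lam s ≠ w k x := fun h => hlt.ne (hinj s hs _ hk (h.trans hnode.symm))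
    rw [sign_neg (sub_neg.mpr (lt_of_le_of_ne hle hne)), sign_neg (sub_neg.mpr hlt)]
  · rw [heq, hnode, sub_self, sub_self]
  · have hle : w k x ≤ lam s := hnode ▸ hm hgt.le
    have hne : lam s ≠ w k x := fun h => hgt.ne' (hinj s hs _ hk (h.trans hnode.symm))
    rw [sign_pos (sub_pos.mpr (lt_of_le_of_ne hle (Ne.symm hne))), sign_pos (sub_pos.mpr hgt)]

/-- The least order statistic is below every value. [folklore] -/
theorem sort_apply_zero_le {q : ℕ} (f : Fin (q + 1) → ℝ) (i : Fin (q + 1)) :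
    f (Tuple.sort f 0) ≤ f i := by
  have h := Tuple.monotone_sort f (Fin.zero_le ((Tuple.sort f).symm i))
  simpa using h

/-- The greatest order statistic is above every value. [folklore] -/
theorem le_sort_apply_last {q : ℕ} (f : Fin (q + 1) → ℝ) (i : Fin (q + 1)) :
    f i ≤ f (Tuple.sort f (Fin.last q)) := by
  have h := Tuple.monotone_sort f (Fin.le_last ((Tuple.sort f).symm i))
  simpa using h

/-- `∃ i, f i ≤ t` iff the least order statistic is `≤ t`. [folklore] -/
theorem exists_apply_le_iff_sort_zero {q : ℕ} (f : Fin (q + 1) → ℝ) (t : ℝ) :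
    (∃ i, f i ≤ t) ↔ f (Tuple.sort f 0) ≤ t :=
  ⟨fun ⟨i, hi⟩ => (sort_apply_zero_le f i).trans hi, fun h => ⟨_, h⟩⟩

/-- `∃ i, t ≤ f i` iff `t ≤` the greatest order statistic. [folklore] -/
theorem exists_le_apply_iff_sort_last {q : ℕ} (f : Fin (q + 1) → ℝ) (t : ℝ) :
    (∃ i, t ≤ f i) ↔ t ≤ f (Tuple.sort f (Fin.last q)) :=
  ⟨fun ⟨i, hi⟩ => hi.trans (le_sort_apply_last f i), fun h => ⟨_, h⟩⟩

end LiftingIngredients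

/-! ## The lifting theorem -/

section Lifting

open Literature.NumberTheory.Transcendental (IsSemialgebraicFunOn IsSemialgebraicMapOn)
open Literature.Analysis.Convexity

/-- **The lifting theorem** [cite: Dries1998, Ch. 8 (2.8)], semialgebraic version with global
sections.  Let `(Φ, K)` be a finite semialgebraic triangulation of `A ⊆ ℝⁿ` with inverse `Ψ`,
and `G₀, …, G_q` continuous semialgebraic functions on `A` which on every cell
`Ψ(Int τ)`, `τ ∈ K`, are pairwise comparable (`<`, `=` or `>` throughout) and satisfy condition
`(*)`: two of them agreeing at the vertices `Ψ(v)`, `v ∈ τ`, agree on the cell.  Then the band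
`A^G = {(x, t) : x ∈ A, minᵢ Gᵢ x ≤ t ≤ maxᵢ Gᵢ x}` has a finite semialgebraic triangulation
`(Φ_L, L)` lifting `(Φ, K)` (`init ∘ Φ_L = Φ ∘ init`), whose open simplices lie over single open
simplices of `K` and are carried by `Ψ_L = Φ_L⁻¹` to a constant side of every section. -/
theorem exists_lifting {n q : ℕ} {A : Set (Fin n → ℝ)}
    {K : Geometry.SimplicialComplex ℝ (Fin n → ℝ)} (hK : K.faces.Finite)
    {Φ Ψ : (Fin n → ℝ) → (Fin n → ℝ)} (hΦ : IsSemialgHomeomorphOn ℝ A K.space Φ Ψ)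
    {G : Fin (q + 1) → (Fin n → ℝ) → ℝ} (hGc : ∀ i, ContinuousOn (G i) A)
    (hGs : ∀ i, IsSemialgebraicFunOn ℝ A (G i))
    (hcomp : ∀ τ ∈ K.faces, ∀ i j, (∀ p ∈ openSimplex ℝ τ, G i (Ψ p) < G j (Ψ p)) ∨
      (∀ p ∈ openSimplex ℝ τ, G i (Ψ p) = G j (Ψ p)) ∨
        (∀ p ∈ openSimplex ℝ τ, G j (Ψ p) < G i (Ψ p)))
    (hstar : ∀ τ ∈ K.faces, ∀ i j, (∀ v ∈ τ, G i (Ψ v) = G j (Ψ v)) →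
      ∀ p ∈ openSimplex ℝ τ, G i (Ψ p) = G j (Ψ p)) :
    ∃ (Lc : Geometry.SimplicialComplex ℝ (Fin (n + 1) → ℝ))
      (ΦL ΨL : (Fin (n + 1) → ℝ) → (Fin (n + 1) → ℝ)), Lc.faces.Finite ∧
      IsSemialgHomeomorphOn ℝ {z | (Fin.init z : Fin n → ℝ) ∈ A ∧
        (∃ i, G i (Fin.init z) ≤ z (Fin.last n)) ∧ ∃ i, z (Fin.last n) ≤ G i (Fin.init z)}
        Lc.space ΦL ΨL ∧
      (∀ z, Fin.init (ΦL z) = Φ (Fin.init z)) ∧ (∀ z, Fin.init (ΨL z) = Ψ (Fin.init z)) ∧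
      ∀ σ ∈ Lc.faces, ∃ τ ∈ K.faces, ∃ ε : Fin (q + 1) → SignType, ∀ z ∈ openSimplex ℝ σ,
        (Fin.init z : Fin n → ℝ) ∈ openSimplex ℝ τ ∧
          ∀ i, SignType.sign (ΨL z (Fin.last n) - G i (Ψ (Fin.init z))) = ε i := by
  classical
  have hA : IsSemialgebraic ℝ A :=
    IsSemialgebraicMapOn.isSemialgebraic_holds hΦ.isSemialgebraicMapOn
  -- the heights
  set ℓ : Fin (q + 1) → (Fin n → ℝ) → ℝ := fun i => plMap K (G i ∘ Ψ) with hℓ_def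
  have hGΨc : ∀ i, ContinuousOn (G i ∘ Ψ) K.space := fun i =>
    (hGc i).comp hΦ.continuousOn_symm hΦ.mapsTo_symm
  have hℓaff : ∀ i, ∀ τ ∈ K.faces, ∃ A' : (Fin n → ℝ) →ᵃ[ℝ] ℝ,
      EqOn (ℓ i) A' (convexHull ℝ (τ : Set (Fin n → ℝ))) := fun i τ hτ => by
    obtain ⟨A', hA', -⟩ := exists_affineMap_eqOn_plMap (K := K) (g := G i ∘ Ψ) hτ
    exact ⟨A', hA'⟩
  have hℓc : ∀ i, ContinuousOn (ℓ i) K.space := fun i => continuousOn_plMap hK _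
  -- order relations between heights and sections on open simplices
  have hlt_imp : ∀ τ ∈ K.faces, ∀ p ∈ openSimplex ℝ τ, ∀ i j,
      G i (Ψ p) < G j (Ψ p) → ℓ i p < ℓ j p := by
    intro τ hτ p hp i j hij
    have hlt : ∀ p' ∈ openSimplex ℝ τ, (G i ∘ Ψ) p' < (G j ∘ Ψ) p' := by
      rcases hcomp τ hτ i j with h | h | h
      · exact h
      · exact absurd (h p hp) hij.ne
      · exact (lt_asymm hij (h p hp)).elim
    exact plMap_lt_plMap_on_openSimplex hτ ((hGΨc i).mono (K.convexHull_subset_space hτ))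
      ((hGΨc j).mono (K.convexHull_subset_space hτ)) hlt (fun hv p' hp' => hstar τ hτ i j hv p' hp')
      p hp
  have heq_imp : ∀ τ ∈ K.faces, ∀ p ∈ openSimplex ℝ τ, ∀ i j,
      G i (Ψ p) = G j (Ψ p) → ℓ i p = ℓ j p := by
    intro τ hτ p hp i j hij
    have heq : EqOn (G i ∘ Ψ) (G j ∘ Ψ) (openSimplex ℝ τ) := by
      rcases hcomp τ hτ i j with h | h | h
      · exact absurd hij (h p hp).ne
      · exact fun p' hp' => h p' hp'
      · exact absurd hij (h p hp).ne'
    exact plMap_eqOn_of_eqOn_openSimplex hτ ((hGΨc i).mono (K.convexHull_subset_space hτ))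
      ((hGΨc j).mono (K.convexHull_subset_space hτ)) heq
      (openSimplex_subset_convexHull (𝕜 := ℝ) _ hp)
  have hle_imp : ∀ τ ∈ K.faces, ∀ p ∈ openSimplex ℝ τ, ∀ i j,
      G i (Ψ p) ≤ G j (Ψ p) → ℓ i p ≤ ℓ j p := fun τ hτ p hp i j h =>
    h.lt_or_eq.elim (fun h' => (hlt_imp τ hτ p hp i j h').le)
      fun h' => (heq_imp τ hτ p hp i j h').le
  -- the nodes: order statistics of the sections and of the heights
  set v : Fin (q + 1) → (Fin n → ℝ) → ℝ :=
    fun k x => (fun i => G i x) (Tuple.sort (fun i => G i x) k) with hv_def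
  set w : Fin (q + 1) → (Fin n → ℝ) → ℝ :=
    fun k x => (fun i => ℓ i (Φ x)) (Tuple.sort (fun i => ℓ i (Φ x)) k) with hw_def
  have hpair : ∀ x ∈ A, ∀ k, w k x = ℓ (Tuple.sort (fun i => G i x) k) (Φ x) := by
    intro x hx k
    obtain ⟨τ, hτ, hp⟩ := exists_mem_openSimplex_of_mem_space (hΦ.mapsTo hx)
    have hx' : Ψ (Φ x) = x := hΦ.left_inv hx
    have key := sort_apply_eq_of_forall_le_imp (a := fun i => G i x) (b := fun i => ℓ i (Φ x))
      (fun i j hij => by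
        have h := hle_imp τ hτ (Φ x) hp i j
        rw [hx'] at h
        exact h hij) k
    exact key
  have hvm : ∀ x ∈ A, Monotone fun k => v k x := fun x _ =>
    Tuple.monotone_sort (fun i => G i x)
  have hwm : ∀ x ∈ A, Monotone fun k => w k x := fun x _ =>
    Tuple.monotone_sort (fun i => ℓ i (Φ x))
  have htie : ∀ x ∈ A, ∀ j : Fin q,
      v (Fin.castSucc j) x = v j.succ x ↔ w (Fin.castSucc j) x = w j.succ x := by
    intro x hx j
    obtain ⟨τ, hτ, hp⟩ := exists_mem_openSimplex_of_mem_space (hΦ.mapsTo hx)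
    have hx' : Ψ (Φ x) = x := hΦ.left_inv hx
    rw [hpair x hx, hpair x hx]
    constructor
    · intro h
      have h' := heq_imp τ hτ (Φ x) hp (Tuple.sort (fun i => G i x) (Fin.castSucc j))
        (Tuple.sort (fun i => G i x) j.succ)
      rw [hx'] at h'
      exact h' h
    · intro h
      by_contra hne
      have hlt : G (Tuple.sort (fun i => G i x) (Fin.castSucc j)) x <
          G (Tuple.sort (fun i => G i x) j.succ) x :=
        lt_of_le_of_ne (Tuple.monotone_sort (fun i => G i x) (Fin.castSucc_lt_succ (i := j)).le) hne
      have h' := hlt_imp τ hτ (Φ x) hp (Tuple.sort (fun i => G i x) (Fin.castSucc j))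
        (Tuple.sort (fun i => G i x) j.succ)
      rw [hx'] at h'
      exact (h' hlt).ne h
  -- continuity and semialgebraicity of the nodes
  have hvc : ∀ k, ContinuousOn (v k) A := by
    intro k
    rw [continuousOn_iff_continuous_restrict]
    exact continuous_sort_apply (X := A) (g := fun i (x : A) => G i x)
      (fun i => continuousOn_iff_continuous_restrict.mp (hGc i)) k
  have hℓΦc : ∀ i, ContinuousOn (fun x => ℓ i (Φ x)) A := fun i =>
    (hℓc i).comp hΦ.continuousOn hΦ.mapsTo
  have hwc : ∀ k, ContinuousOn (w k) A := by
    intro k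
    rw [continuousOn_iff_continuous_restrict]
    exact continuous_sort_apply (X := A) (g := fun i (x : A) => ℓ i (Φ x))
      (fun i => continuousOn_iff_continuous_restrict.mp (hℓΦc i)) k
  have hvs : ∀ k, IsSemialgebraicFunOn ℝ A (v k) := fun k =>
    IsSemialgebraicFunOn.sort_apply hA hGs k
  have hℓΦs : ∀ i, IsSemialgebraicFunOn ℝ A (fun x => ℓ i (Φ x)) := by
    intro i
    choose Aff hAff using hℓaff i
    refine IsSemialgebraicFunOn.of_finset_cover hK.toFinset
      (fun τ => {x | x ∈ A ∧ Φ x ∈ convexHull ℝ (τ : Set (Fin n → ℝ))}) ?_ ?_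
    · ext x
      simp only [mem_iUnion, mem_setOf_eq, Set.Finite.mem_toFinset, exists_prop]
      constructor
      · intro hx
        obtain ⟨τ, hτ, hxτ⟩ := Geometry.SimplicialComplex.mem_space_iff.1 (hΦ.mapsTo hx)
        exact ⟨τ, hτ, hx, hxτ⟩
      · rintro ⟨τ, -, hx, -⟩
        exact hx
    · intro τ hτ'
      have hτ : τ ∈ K.faces := hK.mem_toFinset.mp hτ'
      have hpiece : IsSemialgebraic ℝ {x | x ∈ A ∧ Φ x ∈ convexHull ℝ (τ : Set (Fin n → ℝ))} :=
        IsSemialgebraicMapOn.isSemialgebraic_sep_mem hΦ.isSemialgebraicMapOn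
          (isSemialgebraic_convexHull_of_affineIndependent' (K.indep hτ))
      have hΦ' : IsSemialgebraicMapOn ℝ {x | x ∈ A ∧ Φ x ∈ convexHull ℝ (τ : Set (Fin n → ℝ))} Φ :=
        hΦ.isSemialgebraicMapOn.mono (fun x hx => hx.1) hpiece
      have hco := IsSemialgebraicFunOn.comp_isSemialgebraicMapOn_holds
        (AffineMap.isSemialgebraicFunOn (Aff τ hτ) isSemialgebraic_univ) hΦ' (mapsTo_univ _ _)
      exact hco.congr fun x hx => (hAff τ hτ hx.2).symm
  have hws : ∀ k, IsSemialgebraicFunOn ℝ A (w k) := fun k =>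
    IsSemialgebraicFunOn.sort_apply hA hℓΦs k
  -- the fibre maps, the band maps and the band
  set lam : (Fin n → ℝ) → ℝ → ℝ := fun x s => w 0 x + ∑ j : Fin q,
    (w j.succ x - w (Fin.castSucc j) x) *
      max 0 (min 1 ((s - v (Fin.castSucc j) x) / (v j.succ x - v (Fin.castSucc j) x))) with hlam
  set mu : (Fin n → ℝ) → ℝ → ℝ := fun x t => v 0 x + ∑ j : Fin q,
    (v j.succ x - v (Fin.castSucc j) x) *
      max 0 (min 1 ((t - w (Fin.castSucc j) x) / (w j.succ x - w (Fin.castSucc j) x))) with hmu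
  set ΦL : (Fin (n + 1) → ℝ) → (Fin (n + 1) → ℝ) :=
    fun z => Fin.snoc (Φ (Fin.init z)) (lam (Fin.init z) (z (Fin.last n))) with hΦL
  set ΨL : (Fin (n + 1) → ℝ) → (Fin (n + 1) → ℝ) :=
    fun z => Fin.snoc (Ψ (Fin.init z)) (mu (Ψ (Fin.init z)) (z (Fin.last n))) with hΨL
  set AG : Set (Fin (n + 1) → ℝ) := {z | (Fin.init z : Fin n → ℝ) ∈ A ∧
    (∃ i, G i (Fin.init z) ≤ z (Fin.last n)) ∧ ∃ i, z (Fin.last n) ≤ G i (Fin.init z)} with hAG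
  obtain ⟨Lc, hLcfin, hLcspace, hLccomp⟩ := exists_simplicialComplex_band K hK ℓ hℓaff
  have hAG' : ∀ z, z ∈ AG ↔ Fin.init z ∈ A ∧ v 0 (Fin.init z) ≤ z (Fin.last n) ∧
      z (Fin.last n) ≤ v (Fin.last q) (Fin.init z) := by
    intro z
    simp only [hAG, mem_setOf_eq, hv_def]
    rw [exists_apply_le_iff_sort_zero (fun i => G i (Fin.init z)),
      exists_le_apply_iff_sort_last (fun i => G i (Fin.init z))]
  have hΛ' : ∀ z, z ∈ Lc.space ↔ Fin.init z ∈ K.space ∧ w 0 (Ψ (Fin.init z)) ≤ z (Fin.last n) ∧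
      z (Fin.last n) ≤ w (Fin.last q) (Ψ (Fin.init z)) := by
    intro z
    rw [hLcspace]
    simp only [mem_setOf_eq]
    constructor
    · rintro ⟨hzK, h1, h2⟩
      have hp : Φ (Ψ (Fin.init z)) = Fin.init z := hΦ.right_inv hzK
      simp only [hw_def, hp]
      exact ⟨hzK, (exists_apply_le_iff_sort_zero _ _).mp h1,
        (exists_le_apply_iff_sort_last _ _).mp h2⟩
    · rintro ⟨hzK, h1, h2⟩
      have hp : Φ (Ψ (Fin.init z)) = Fin.init z := hΦ.right_inv hzK
      simp only [hw_def, hp] at h1 h2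
      exact ⟨hzK, (exists_apply_le_iff_sort_zero _ _).mpr h1,
        (exists_le_apply_iff_sort_last _ _).mpr h2⟩
  obtain ⟨hmaps, hmaps', hlinv, hrinv, hcΦL, hcΨL⟩ := band_homeomorph hΦ.mapsTo hΦ.mapsTo_symm
    (fun x hx => hΦ.left_inv hx) (fun p hp => hΦ.right_inv hp) hΦ.continuousOn
    hΦ.continuousOn_symm hvc hwc hvm hwm htie (lam := lam) (mu := mu) (fun _ _ => rfl)
    (fun _ _ => rfl) hAG' hΛ' (ΨL := ΦL) (ΦL := ΨL) (fun _ => rfl) (fun _ => rfl)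
  obtain ⟨-, hsa⟩ := band_isSemialgebraicMapOn hA hΦ.isSemialgebraicMapOn hvs hws (lam := lam)
    (fun _ _ => rfl) hAG' (ΨL := ΦL) (fun _ => rfl)
  refine ⟨Lc, ΦL, ΨL, hLcfin, ⟨hmaps, hmaps', hlinv, hrinv, hcΦL, hcΨL, hsa⟩,
    fun z => by simp [hΦL], fun z => by simp [hΨL], ?_⟩
  -- compatibility
  intro σ hσ
  obtain ⟨τ, hτ, ε, hε⟩ := hLccomp σ hσ
  refine ⟨τ, hτ, ε, fun z hz => ?_⟩
  obtain ⟨hzτ, hsign⟩ := hε z hz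
  refine ⟨hzτ, fun i => ?_⟩
  have hpK : Fin.init z ∈ K.space := openSimplex_subset_space hτ hzτ
  have hxA : Ψ (Fin.init z) ∈ A := hΦ.mapsTo_symm hpK
  have hΦΨ : Φ (Ψ (Fin.init z)) = Fin.init z := hΦ.right_inv hpK
  have hzΛ : z ∈ Lc.space :=
    Geometry.SimplicialComplex.convexHull_subset_space hσ (openSimplex_subset_convexHull (𝕜 := ℝ) _ hz)
  obtain ⟨-, ht1, ht2⟩ := (hΛ' z).mp hzΛ
  -- the rank `k` of the section `i` at `Ψ (init z)`
  set k := (Tuple.sort fun i => G i (Ψ (Fin.init z))).symm i with hk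
  have hki : (Tuple.sort fun i => G i (Ψ (Fin.init z))) k = i := Equiv.apply_symm_apply _ _
  have hvk : v k (Ψ (Fin.init z)) = G i (Ψ (Fin.init z)) := by
    simp only [hv_def]
    rw [hki]
  have hwk : w k (Ψ (Fin.init z)) = ℓ i (Fin.init z) := by
    rw [hpair _ hxA, hki, hΦΨ]
  have hlast : ΨL z (Fin.last n) = mu (Ψ (Fin.init z)) (z (Fin.last n)) := by
    simp [hΨL]
  rw [hlast, ← hvk, ← hsign i, ← hwk]
  let v' : Fin (q + 1) → A → ℝ := fun k x => v k x
  let w' : Fin (q + 1) → A → ℝ := fun k x => w k x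
  exact plInterpolant_sign (v := w') (w := v') (fun x => hwm x x.2) (fun x => hvm x x.2)
    (fun j x => (htie x x.2 j).mpr) (fun j x => (htie x x.2 j).mp) ⟨Ψ (Fin.init z), hxA⟩
    ⟨ht1, ht2⟩ k

end Lifting

end Literature.ModelTheory.ExponentialFields
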